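import Literature.Analysis.FluidPDE.StokesTorus
import Literature.Analysis.FluidPDE.LerayHopf
import HarnessLib

/-!
# Barrier (AnomalousDissipation): absence of turbulence at every Reynolds number for
first-mode forcing in two dimensions (Marchioro's trivial attractor)
(D-0021 barrier catalogue for `Summits/AnomalousDissipation`; summit statement
`AnomalousDissipation := Literature.Turb.ZerothLaw`; bears on two-dimensional and `x₃`-invariant
("two-and-a-half-dimensional") scenarios and on steady-state branches)

Marchioro, *An example of absence of turbulence for any Reynolds number*, Comm. Math. Phys.
105 (1986) 99–106, Theorem (p. 100): for the 2-D Navier–Stokes equations on the flat torus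
driven by a particular force `f₀` in the first Fourier shell there is, "for any Reynolds number
`R`", "a stable stationary state which attracts exponentially each solution", and the same
holds for forces in a neighbourhood of `f₀` (depending on `R`). In the form proved in
Constantin–Foias–Temam (Physica D 30 (1988)) and presented in Foias–Manley–Rosa–Temam,
*Navier–Stokes Equations and Turbulence* (CUP 2001), Ch. III §3.1, (3.31)–(3.35) with the proof
in Appendix III.A.4: on the square periodic box of side `L`, let
`f(x) = (0, α√2 sin(2πx₁/L))` (op. cit. (3.31); more generally any `f` with `Af = λ₁f` and
`B(f,f) = 0`, (3.32)–(3.33)), `λ₁ = 4π²/L²`; then `ū = f/(νλ₁)` is a fixed point of the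
Navier–Stokes equations ((3.34)) and *every* solution with initial condition `u₀ ∈ H`
satisfies `lim_{t→∞} |u(t) - ū| = 0` ((3.35), `|·|` the `L²` norm), so "we may have `G`
arbitrarily large, yet the global attractor may be reduced to a single point" (op. cit. p. 150
of the print edition, PDF p. 163). Consequently the long-time statistics of every solution are
those of the laminar state: `|ū|² = |f|²/(ν²λ₁²)` and `ν‖ū‖² = |f|²/(νλ₁)`, i.e. in the
summit's normalisation `β = εℓ/U³ ∝ Re⁻¹`, with unbounded energy as `ν → 0` at fixed `f ≠ 0`.

## What is vendored

* `marchioroForce α` — the force (3.31) on the flat **unit** torus `T² = UnitAddTorus (Fin 2)`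
  (`L = 1`, `λ₁ = 4π²`): `x ↦ α√2 sin(2πx₀) e₁`, written with the accepted real Stokes
  eigenfield `Torus.stokesMode` (`Literature.Analysis.FluidPDE.StokesTorus`; frequency
  `k = (1,0)`, amplitude `α√2 e₁ ⊥ k`, sine branch); `marchioroLaminarState α ν = (4π²ν)⁻¹ • f`
  is the fixed point (3.34).
* `Marchioro1986_globalAttraction` — (3.35) as printed: for every `ν > 0`, every datum
  `u₀ ∈ H` (square integrable, weakly divergence free, mean zero) and every global Leray–Hopf
  solution `u` of the 2-D Navier–Stokes equations on `T²` with viscosity `ν` and steady force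
  `marchioroForce α` (accepted `Torus.IsGlobalLerayHopf`; in 2-D these are unique, so "every
  solution" and "the solution" agree), `‖u(t) - ū‖_{L²} → 0` as `t → ∞`. Marchioro's
  exponential rate and his perturbative statement (forces near `f₀`) are recorded in prose only.
* `Marchioro1986_globalAttraction.steadyState_ae_eq` — proved corollary: any *steady*
  Leray–Hopf solution with this force coincides a.e. with the laminar state (uniqueness of
  steady states, the form in which the barrier meets steady-branch scenarios).
* The barrier docstring block sits on `Marchioro1986_globalAttraction`.
* Audit 2026-08-15 (D-0021 barrier audit, appended): the Galilean drift family
  `marchioroDriftState α ν c` of exact steady solutions with mean momentum `c` (bounded energy,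
  vanishing dissipation as `ν → 0` when `c·k ≠ 0`; proved algebra `driftCoeff_steady_system`,
  `sq_add_sq_driftCoeff`, `norm_marchioroDriftState_sub_le`, `marchioroDriftState_zero`) and the
  sharpened `blocks:` / `scope_caveats:` / `evasions_known:` of the barrier block (mean-zero data
  essential — the cruxes of route TwoAndHalfD are covered only in their mean-zero reading; 3-D
  gravest-mode forcing is subcritically turbulent; higher shells are unstable). The any-mean
  (drift-closed) form of the theorem — every Leray–Hopf solution with mean momentum `c` converges
  to `marchioroDriftState α ν c`, by the Galilean reduction FMRT Ch. II (2.6)–(2.9) run through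
  App. III.A.4 — is not printed as such and is recorded in prose only (audit claim; its `c = 0`
  slice is the theorem `Marchioro1986_globalAttraction_holds` of the Proofs sibling).
* Audit 2026-08-15, generation 3 (D-0021 barrier audit of the support file
  `GravestModeLaminarAttractorExcess`, appended; statements unchanged): CONFIRMED. The two named
  halves of the Excess file and this block were re-read against the printed pages (FMRT PDF
  pp. 163–164 and 178–180; Marchioro 1986 pp. 99–100 and 106; van Veen–Goto §2.2; Chandler–
  Kerswell §4.1) and every named sub-fact is a theorem of the tree (`…_holds`, axioms `propext`,
  `Classical.choice`, `Quot.sound`). Three printed or elementary facts sharpen `evasions_known:` /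
  `scope_caveats:` below without changing any statement: (i) Marchioro's admissible perturbation
  of the force is quantified in print, `‖f₁‖²_{L²} < ε₁(R₀)ν²` and `‖curl f₁‖²_{L²} < ε₂(R₀)ν²`
  ((7)–(9) and Theorem, p. 100) — an `O(ν)`-neighbourhood; (ii) on the short torus `L < 2π` he
  announces an `R`-independent open set of rigid forces (Note added in proof, p. 106; Part II,
  Marchioro 1987, not held: acquisition acq-00421); (iii) (A.32)–(A.34) are indifferent to the
  time dependence of a first-shell-valued force, and `b(P₄v,P₄v,ū) = 0` needs only that `P₄v`
  lies in ONE eigenspace of the Stokes operator (`B(w,w) = 0` in `H` for single-shell `w` on every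
  flat 2-torus), so the theorem holds verbatim on every flat torus `ℝ²/Λ` for forces in its first
  eigenspace (audit observations; the time-dependent extension is idea card
  `first-shell-enslaving-dichotomy`).
* Audit 2026-08-15, generation 4 (D-0021 barrier audit of the support file
  `GravestModeLaminarAttractorExcess`, appended; statements unchanged): CONFIRMED. Pages re-read
  (FMRT PDF pp. 163–164 and 178–180; Marchioro 1986 pp. 99–100 and 106, now held as
  doi:10.1007/BF01212343 — his `f₀` of (5) is `νū + (ū·∇)ū` for the general first-shell field `ū`
  of (12), and `(ū·∇)ū` is a gradient, so the Leray-projected force is the first-shell field `νū`,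
  as in FMRT (3.32)–(3.33)); the discharge re-checked (`Marchioro1986_globalAttraction_holds`,
  axioms `propext`, `Classical.choice`, `Quot.sound`). Two independent confirmations: for `k = 1`
  on the square torus every solution "is attracted by a single steady-state solution for all real
  `λ`", after Meshalkin–Sinai, "also re-proved by Marchioro" (Chen–Price 1997, p. 301, whose
  bifurcations are all at `k ≥ 2`); and white-noise forcing of the 2-D equations spreads to all
  Fourier modes iff the forced set generates `ℤ²` and contains "at least two elements with unequal
  euclidean norm" (Hairer–Mattingly 2004, Prop. 1.1) — forcing confined to one shell never leaves
  it, the ergodic-theory face of the same rigidity (`B(w,w) = 0` in `H` for single-shell `w`). One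
  printed over-statement flagged: FMRT p. 164, "even if the boundary conditions are different", is
  not delivered by App. III.A.4, whose (A.32) rests on the periodic identity `(B(u,u), Au) = 0`
  (II.A.62) and whose `b(P₄v,P₄v,ū) = 0` is read off the Fourier basis (II.6.17); the block stays
  periodic. One gap closed on paper (see `evasions_known:`): with drifting data the transported
  third component of an `x₃`-invariant witness cannot carry the anomaly either, so the whole
  `x₃`-invariant class with a steady planar force in the first shell is dead for the zeroth law,
  for all data — no statement of this file or of the Excess file changes.
* Audit 2026-08-15, generation 6 (D-0021 barrier audit of the support file
  `GravestModeLaminarAttractorExcess`, appended; statements unchanged): CONFIRMED, and the bite of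
  the barrier on the two-and-a-half-dimensional class EXTENDED from the first shell to every
  single Stokes eigenspace. Re-checked: both named halves of the Excess file and this block are
  theorems of the tree (`…_holds`, axioms `propext`, `Classical.choice`, `Quot.sound`); Marchioro's
  pages re-read (pp. 99–100: the force (5) is built on the general four-parameter first-shell
  field (12), cellular members included; p. 106). New printed evidence: the mechanism of (A.32)
  is not tied to the FIRST shell. For a force valued in ANY single eigenspace `E_λ` of the Stokes
  operator (`|k|²` constant on the Fourier support; steady or time dependent) one still has
  `(f, Au) = λ(f, u)`, so `ξ = ‖u‖² - λ|u|²` obeys `½ξ' + νλξ = -ν Σ_k (λ_k - λ)²|û_k|² ≤ 0`,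
  `ξ(t) ≤ ξ(t₀)e^{-2νλ(t-t₀)}`, and on the global attractor `‖u‖² ≤ λ|u|²` — Tran–Shepherd's
  "dynamical constraint" (Physica D 165 (2002), §4, eq. (ξ) and (constraint), valid "whether or
  not the monoscale forcing `f ∈ H(λ_s)` is time-independent"), after Constantin–Foias–Manley
  1994 ("for … forcing of a single length scale, the KLB scaling laws cannot be achieved on the
  global attractor", op. cit. §1; "the forcing term must have at least two eigenmodes", FMRT 2001,
  Ch. IV introduction, PDF p. 218; "In the case where the force is in a single eigenspace of the
  Stokes operator the flow is known not to be turbulent", Dascaliuc–Foias–Jolly 2010, §1); in the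
  long-time means `ε = ν⟨‖∇u‖²⟩ ≤ νλ⟨|u|²⟩` and `χ = ν⟨‖∇ω‖²⟩ = λε ≤ νλ²⟨|u|²⟩`
  (Alexakis–Doering 2006, §4 "Monochromatic and constant flux forces": `ε ≤ νk_f²U²`,
  `χ ≤ νk_f⁴U²`, "both `β` and `γ` are bounded by `Re⁻¹`"). For `λ = λ₁` Poincaré gives
  `ξ ≥ 0`, hence `ξ → 0` and Marchioro's laminarity; for `λ > λ₁` the flow may be chaotic with a
  full spectrum (Meshalkin–Sinai / Iudovich instability; Tran–Shepherd §2 on Bowman's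
  simulations), but its ENSTROPHY IS SLAVED below `λ ×` energy at every `ν`. Consequence for the
  summit (audit claim = the printed dynamical constraint + the renormalisation engine of idea
  card `diperna-lions-l1-vorticity-margin`, whose open crux Q2 — a ν-uniform `L¹` vorticity
  bound — it settles in `L²` with room to spare): in the `x₃`-invariant class with steady smooth
  force `f = (g, h)` whose PLANAR part `g` lies in one Stokes eigenspace of `T²` (Kolmogorov
  `sin(2πn x₁)e₀` for every `n`, single-shell cellular and oblique forcings; any smooth `h`),
  every vanishing-viscosity Leray–Hopf family with bounded mean energy `E` has mean dissipation
  `→ 0`: the planar part is `≤ νλE`; for the scalar `w`, the stationary statistics at `ν_j > 0`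
  carry `E‖∇v‖² ≤ λE` and `ν_j E‖∇w‖² = E(h, w)`, are tight as `ν_j → 0` (Aubin–Lions for `v`,
  weak-`L²` paths for `w`), every limit is a stationary law of pairs `(v̄, w̄)` with
  `v̄ ∈ L²_t H¹_x`, `w̄ ∈ L^∞_t L²_x` solving `∂ₜw̄ + div(v̄ w̄) = h` in `𝒟'`, which is
  renormalised (DiPerna–Lions commutator lemma with `∇v̄ ∈ L²_{t,x}`, `w̄ ∈ L²_{t,x}`), so
  stationarity of `E∫β_M(w̄)` gives `E(h, w̄) = 0` and, `(h, ·)` being weakly continuous and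
  uniformly integrable, `ν_j⟨‖∇w_j‖²⟩ = ⟨(h, w_j)⟩ → 0`. Hence `TwohalfdNeg` (stmt 0211) holds
  on the whole single-shell-planar-forcing subclass, and a TwoAndHalfD witness (stmts 0206/0448)
  needs planar forcing with at least TWO distinct shell radii (cf. Hairer–Mattingly's "at least
  two elements with unequal euclidean norm") together with planar vorticity escaping ν-uniform
  `L²` bounds — the route file's "evasion: `g` above the first shell, where nothing is printed"
  is superseded. The spectral core `Ψ_λ ≥ λΦ_λ` of the pincer is proved below
  (`shellPincer_spectral`); `evasions_known:` / `scope_caveats:` sharpened; idea-card seed filed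
  in the audit notes. Not obtainable this pass: Marchioro 1987 II (acq-00421, cite-only),
  Constantin–Foias–Manley 1994 (acq-01732), Dascaliuc–Foias–Jolly 2005 (acq-01710),
  Foias–Jolly–Yang 2013 "On single mode forcing of the 2D-NSE" (acq-01694; by Meshalkin–Sinai it
  cannot extend laminarity beyond `E₁` on the square torus), Gallet–Young 2013 (acq-01680).
* Audit 2026-08-15, generation 7 (D-0021 barrier audit of the support file
  `GravestModeLaminarAttractorExcess`, appended; statements unchanged): CONFIRMED. Re-checked in
  Lean: `Marchioro1986_globalAttraction_holds` and both named halves of the Excess file are theorems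
  (axioms `propext`, `Classical.choice`, `Quot.sound`). Three sharpenings, none changing a
  statement. (i) PRINTED ANCHOR for the scalar half of the generation-6 extension: a bounded
  divergence-free field with the DiPerna–Lions renormalisation property (e.g. `W^{1,1}` in space)
  carries NO scalar dissipation anomaly — `lim_{ε→0} ε∫₀ᵀ∫|∇θ_ε|² = 0` with strong `C_tL²`
  convergence, for every bounded datum (Bagnara–Boutros–De Lellis–Mayboroda 2026, Thm. 3.1,
  "folklore ... useful to give precise statements"); the stationary, sourced, `ν`-dependent-field
  form used in generation 6 (fields bounded in `L²_ωL²_tH¹_x`, scalars in `L²`, `p = q = 2` in the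
  commutator lemma) remains an audit extrapolation of it. (ii) THE PINCER BEYOND ONE SHELL, as
  printed: Tran–Shepherd's constraint survives for "monoscale-like" forcing over a band
  `λ_min ≤ λ_k ≤ λ_max` — `(Au, f) ≤ λ_max(u, f)`, `(u, f) ≥ 0` — "with `λ_s` replaced by `λ_max`",
  and "if (monoscale-like) only holds in a time-mean sense ... `⟨‖u‖₁²⟩ ≤ λ_max⟨‖u‖²⟩`"
  (Physica D 165 (2002), §4, closing paragraphs); the only escape for a band-limited force is the
  Constantin–Foias–Manley configuration that "injects energy at higher wavenumbers and removes
  energy at lower (though possibly nearby) wavenumbers" (op. cit. §1). For a general force the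
  weighted balance reads `½ξ' ≤ -νλξ + [(f, Au) - λ(f, u)]` with the INJECTION DEFECT
  `(f, Au) - λ_max(f, u) = -∑_k(λ_max - λ_k)(u, f_k)` (single shell: defect `≡ 0`, generation 6);
  proved at the Galerkin level for arbitrary force coefficients in the sibling
  `GravestModeLaminarAttractorBandPincer` (`sum_shellWeight_mul_re_inner_galerkinField_le_add_defect`,
  `shellWeight_defect_nonpos_of_band`, `galerkin_shellExcess_le_mul_exp_of_defect_nonpos`,
  `galerkin_shellExcess_le_mul_exp_of_band`). Consequence for route TwoAndHalfD (design rule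
  sharpened, see `evasions_known:`): with a band-limited steady planar force the planar flow keeps
  ν-uniform MEAN `H¹` bounds — and the third component stays anomaly-free — unless it does
  NEGATIVE mean work on the lower forced shells, `∑_{λ_k<λ_max}(λ_max - λ_k)⟨(v_j, g_k)⟩ < 0`, by an
  amount `≫ ν_j` ("two shell radii" is necessary, not sufficient: the steady force must act as a
  net SINK on its lower shells while injecting at the top one). (iii) TOKEN READING: the caveat
  "`kolmogorov-type-forcing` means `n = 1`" limits LAMINARITY only; the zeroth-law blocking in the
  `x₃`-invariant class covers every single forced shell (generation 6) and every band-limited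
  planar force with non-negative lower-shell mean work (this generation). Literature state:
  `searchd` unreachable during the audit (held texts re-read: Tran–Shepherd §1, §4; BBDM 2026 §2.1,
  §3.1); Constantin–Foias–Manley 1994 (acq-01732), Foias–Jolly–Yang 2013 (acq-01694),
  Dascaliuc–Foias–Jolly 2005 (acq-01710), Gallet–Young 2013 (acq-01680) still not held.
* Audit 2026-08-15, generation 8 (D-0021 barrier audit of the support file
  `GravestModeLaminarAttractorExcess`, appended; statements unchanged): CONFIRMED. Re-checked in
  Lean: `Marchioro1986_globalAttraction_holds` and both named halves of the Excess file are
  theorems (axioms `propext`, `Classical.choice`, `Quot.sound`); pages re-read (FMRT PDF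
  pp. 163–164, 178–180, 218; Hairer–Mattingly 2004 Prop. 1.1; zbMATH 0607.76052 / 0617.76059).
  No narrowing found: every candidate gap (non-zero mean / Galilean drift, time-dependent
  first-shell stirring, higher single shells, band-limited forcing, three dimensions, boundary
  conditions, aspect ratio, `j`-dependent data, the `limsup`/junk conventions of
  `Literature.Turb.ZerothLaw`) is already recorded below and was re-derived. Three additions,
  none changing a statement. (i) NEW PRINTED ANCHOR for the single-shell pincer of generation 6,
  in exactly the ν-uniform form the two-and-a-half-dimensional blocking uses: for "Kolmogorov
  forcing" `Af = λf` at ANY eigenvalue on the periodic square, `B(u,u) = 0` on every single energy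
  shell, steady families with `|u^{(ν)}|² ≤ E` obey `|Au^{(ν)}|² = λ‖u^{(ν)}‖² ≤ λ²E` and converge
  to steady forced Euler states, and along every trajectory `δ = ‖u‖² - λ|u|²` satisfies
  `δ' + 2νμδ ≤ 0`, `δ(t) ≤ δ₊(0)` — "an automatic viscosity independent and time independent
  bound on `‖u‖_{H¹}` given a viscosity independent and time independent bound on `‖u‖_{L²}`",
  `sup_{ν,t}‖S^{(ν)}(t,u₀)‖² ≤ λE + δ₊(0)`; "stable in 2D if `λ` is the first eigenvalue"
  (Constantin–Tarfulea–Vicol, ARMA 212 (2014) = arXiv:1305.7089, §1 and §2, eqs. (buuls),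
  (h2bal)–(steu), (diffeq)–(enst)); in particular STEADY BRANCHES with single-shell forcing have
  dissipation `≤ νλE → 0` at bounded energy whatever the shell (token
  `steady-or-statistical-branches`, any shell, printed). (ii) The scalar half of the blocking was
  re-derived in the summit's exact semantics — deterministic `j`-dependent data, `⟨·⟩ = limsup` of
  Cesàro means: a ν-uniform bound on the limsup-mean planar enstrophy together with bounded
  `meanEnergy` forces `meanDissipation → 0` in the `x₃`-invariant class (energy equality of the
  third component, Krylov–Bogoliubov measures along a realising sequence `T_n → ∞` as in CTV 2014
  §6 Thm. 3, tightness by Aubin–Lions, DiPerna–Lions renormalisation of the limit transport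
  equation with `p = q = 2`, stationarity, uniform integrability of `(h, ·)`; written out in the
  header of sibling `GravestModeLaminarAttractorTimePincer`) — so an `x₃`-invariant witness needs
  UNBOUNDED limsup-mean planar enstrophy (audit argument; printed skeleton CTV 2014 §4–§7 for SQG
  energy; cf. idea card `diperna-lions-l1-vorticity-margin` for the harder `L¹`-vorticity margin).
  (iii) PROVED at the Galerkin level, sibling `GravestModeLaminarAttractorTimePincer`: the pincer
  with injection defect for TIME-DEPENDENT force coefficients `g : ℝ → (S → ℂ²)`
  (`galerkin_shellExcess_le_mul_exp_of_defect_nonpos_td`, single-shell and band corollaries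
  `…_of_shell_td`, `…_of_band_td` — the formal kernel of the generation-3 remark on time-dependent
  first-shell forces and of Tran–Shepherd's "whether or not the monoscale forcing is
  time-independent"), and the QUANTITATIVE cap `ξ(t) ≤ max (ξ(0)) (D/(4π²mν))` for a defect bounded
  by `D` on `[0, T]` (`galerkin_shellExcess_le_max_defect_div_td`): planar enstrophy in excess of
  `λ ×` energy costs weighted negative lower-shell work `≳ νλ ×` excess, the design rule of
  generation 7 quantified. Literature state: OpenAlex/Semantic Scholar rate-limited and the
  `searchd` full-text leg intermittent during the audit (zbMATH, Crossref, arXiv, galaxy reachable);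
  Marchioro 1987 II (acq-00421, cite-only), Gallet–Young 2013 (acq-01680), Foias–Jolly–Yang 2013
  (acq-01694), Constantin–Foias–Manley 1994 (acq-01732) still not held.
* Audit 2026-08-15, generation 9 (D-0021 barrier audit of the support file
  `GravestModeLaminarAttractorExcess`, appended; statements unchanged): CONFIRMED. Re-checked in
  Lean: `Marchioro1986_globalAttraction_holds` and both named halves of the Excess file are theorems
  (axioms `propext`, `Classical.choice`, `Quot.sound`). No narrowing found; four further candidate
  gaps were tested and closed on paper. (a) OBLIQUE INVARIANCE DIRECTIONS: a two-and-a-half-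
  dimensional class of `T³` along a rational direction other than a coordinate axis (e.g.
  invariance under `x ↦ x + s(1,1,0)`) lives on a NON-square flat quotient torus (coordinates
  `(x₀ - x₁, x₂)`, side ratio `√2`), the passive component being `u·(1,1,0)/√2` and the planar flow
  2-D Navier–Stokes on that torus; its first Stokes eigenspace is the two-dimensional Kolmogorov
  family `φ(x₂)(1,-1,0)` (Marchioro on `ℝ²/Λ`, generation 3) and every single forced shell is caught
  by the lattice-free pincer of generation 6 — covered (the route file fixes `e₃`, so nothing changes
  for TwoAndHalfD). (b) VERTICAL-ONLY FORCING with drifting planar data (`g = 0`, smooth mean-zero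
  `h`, planar mean momentum `c_j`, possibly `j`-dependent, resonant — `c_j·k = 0` for some mode
  `k` of `h` — or not): at fixed `ν` the planar flow decays to the drift `c_j` and the third
  component relaxes to the stationary response `ŵ(k) = ĥ(k)/(4π²ν|k|² + 2πi c_j·k)`, whose mode-`k` dissipation is exactly
  `4π²ν|k|²` times its mode-`k` energy; with mean energy `≤ E` the dissipation is
  `≤ 4π²νK²E + ‖h_{>K}‖_{L²}E^{1/2}` for every `K`, hence `→ 0`: no drift, resonant or not, turns a
  bounded-energy family into a witness ("dissipation `= νK_eff ×` energy" with no enhancement at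
  all; the shear-plus-drift states of generation 4 give at best `νK_eff ≲ ν^{1/2}`). (c) LERAY–HOPF
  BOOKKEEPING of the reduction: the planar part of an `x₃`-invariant Leray–Hopf solution on `T³`
  satisfies the 2-D weak formulation with `L^∞L² ∩ L²H¹` bounds, hence the 2-D energy equality, and
  IS a 2-D Leray–Hopf solution (unique, `NS.lions_prodi_uniqueness_torus2`); the pressure of an
  `x₃`-invariant solution has no `x₃`-gradient on the torus, so the third component is exactly
  passive; and energy-class weak solutions of the sourced advection–diffusion equation at fixed
  `ν > 0` in the (instantly smoothing) planar field are unique — neither component has a "wild"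
  branch escaping the blocking, and the cruxes 0209/0448, which quantify over 2-D Leray–Hopf `v_j`
  directly, are met by the reduction as typed. (d) The drift-closed form of the theorem (audit claim of 2026-08-15) was
  re-derived independently: in the co-moving frame the force `f_α(· + ct)` is first-shell valued at
  every instant, (A.32)–(A.34) and the first-shell linear response go through, and back in the
  laboratory frame `u(t) → c + ∫₀^∞ e^{-νλ₁τ} f_α(· - cτ) dτ`, whose `sin 2πx₀`/`cos 2πx₀` amplitudes
  are `α√2·νλ₁/(ν²λ₁² + 4π²c₀²) = driftSinCoeff α ν c₀` and `-α√2·2πc₀/(ν²λ₁² + 4π²c₀²) =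
  driftCosCoeff α ν c₀` (`λ₁ = 4π²`) — consistent with the proved algebra below. NEW IN LEAN (sibling
  `GravestModeLaminarAttractorLattice`, this generation): the arithmetic behind "all three entries
  are eigenfunctions associated with the smallest eigenvalue" (FMRT App. III.A.4, p. 180; in tree
  `freqNormSq_add_ne_one`) is not special to `λ₁` — on `ℤ²` no two frequencies of equal length sum
  to one of the same length (`freqNormSq_add_ne_of_eq`: by Lagrange's identity an equal-norm triad
  would give `4(l × m)² = 3|l|⁴`, i.e. `√3 ∈ ℚ`), so the convection symbol of two shell-supported
  coefficient families has no output on that shell (`convectionCoeff_eq_zero_of_shellSupported`) and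
  the trilinear form vanishes on `E_λ × E_λ × E_λ` for EVERY Stokes eigenvalue of the square torus
  (`integral_inner_convect_realTrigPoly_eq_zero_of_shellSupported`); scope stated there — a
  square-lattice fact (equal-norm triads exist on hexagonal and on aspect-ratio-`√3` rectangular
  tori), complementary to the lattice-free `B(w,w) = 0` in `H` behind the pincer
  [ConstantinTarfuleaVicol2013 §2, HairerMattingly2004 Prop. 1.1], and NOT a laminarity statement
  above the first shell (it says only that in the forced shell's energy balance every
  self-interaction drops out, the forced shell being driven by the unforced ones alone). Consistency
  with the idea catalogue checked: for single-shell planar forcing the blocking of generation 6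
  (bounded energy ⇒ scalar dissipation `→ 0`) and the card `batchelor-log-barrier-tame-strain`
  (tame stirring + anomaly ⇒ variance `≳ log(1/ν)`) are two faces of the same corner. Literature
  state during the audit: the local full-text index (`searchd`) timed out and OpenAlex / Semantic
  Scholar were rate-limited; Crossref, zbMATH, arXiv and the galaxy corpora were reachable;
  Foias–Jolly–Yang 2013 (doi:10.1007/s10884-013-9301-x, acq-01694, requester added), Marchioro 1987
  II (acq-00421), Constantin–Foias–Manley 1994 (acq-01732), Gallet–Young 2013 (acq-01680) still not
  held; broad-discovery sweeps ("single mode forcing of the 2D", "absence of turbulence for any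
  Reynolds number", Kolmogorov/monoscale forcing in 2D3C and thin layers) surfaced only known
  neighbours — Chen–Price 1997 (held in galaxy), Farazmand–Sapsis 2017 and Tithof et al. 2017
  (Kolmogorov flow at forcing wavenumber `≥ 2`), van Veen–Goto 2016, Benavides–Alexakis 2017 and
  Poujol–van Kan–Alexakis 2020 (thin-layer / 2D3C transitions, stochastic forcing with large-scale
  drag) — none bearing on steady first-shell or single-shell planar forcing without drag.
* Audit 2026-08-15, generation 11 (D-0021 barrier audit of the support file
  `GravestModeLaminarAttractorExcess`, appended; statements unchanged): CONFIRMED. Re-checked in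
  Lean: both named halves of the Excess file and `Marchioro1986_globalAttraction_holds` are theorems
  (axioms `propext`, `Classical.choice`, `Quot.sound`); no narrowing found; the drift-closed form,
  the near-resonant-drift bound of generation 9 (b) and the single-shell two-and-a-half-dimensional
  blocking chain of generation 6 (pincer in limsup means at fixed `ν_j`, Krylov–Bogoliubov laws,
  Aubin–Lions for the planar flow, DiPerna–Lions with `p = q = 2` in space–time, stationarity of the
  renormalised scalar budget) were re-derived on paper without change. NEW PRINTED ANCHOR — priority
  and sharpness in the aspect ratio (Okamoto–Shōji, Japan J. Indust. Appl. Math. 10 (1993), read in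
  the RIMS Kôkyûroku 767 (1991) version, pp. 31–36): for Kolmogorov's problem on the flat torus
  `T_α = [-π/α, π/α] × [-π, π]` with Kolmogorov's force `γ sin(πy/b) e_x` ((1.1); `R⁻¹cos y` in the
  nondimensional vorticity form (2.2), `R = γb³/(ν²π³)`; zero-mean velocities, p. 31) — a force
  lying in the FIRST Stokes eigenspace of `T_α` exactly when `α ≥ 1` (eigenvalues `m²α² + n²`) —
  (i) "THEOREM 3.1 (IUDOVICH [11]). For any `1 ≤ α < +∞`, `0 < R < ∞` and any initial value
  `φ(0, x, y) ∈ H⁴(T_α)/ℝ`, the solution … decays exponentially toward the zero solution as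
  `t → +∞`. Namely the basic solution is globally stable for any Reynolds number if `α ≥ 1`", with
  the Remark "Marchioro [17] rediscovered this theorem recently, although his result is slightly
  more general than Iudovich's" (p. 34): the theorem of this file is Iudovich's (1965) on every
  rectangular torus whose gravest mode is the forced one — the printed form, for rectangular
  lattices and `H⁴` stream functions, of the generation-3 remark "every flat torus `ℝ²/Λ`, force in
  its first eigenspace" (Marchioro's generality: `L²` data, the whole first shell, an
  `O(ν)`-neighbourhood of forces); (ii) the complement is sharp and continuous in
  `α`: for `0 < α < 1` the basic flow is neutrally stable exactly on Iudovich's curve `R = R*(α)`,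
  `R*` strictly increasing with `R*(α) → √2` as `α → 0` and `R*(α) → +∞` as `α → 1` (Lemma 3.1,
  p. 33; exchange of stabilities at the basic flow, Prop. 3.1 after Meshalkin–Sinai, p. 32), so
  "globally attracting for every `R`" holds if and only if the forced mode is the gravest one;
  (iii) numerically, for `0.966 < α < 1` the mode-one branch folds and at `α = 0.999` non-laminar
  steady states exist already for `R < R*(α)` — "basic solution is stable but not globally stable"
  (§4, p. 36): immediately below the first-eigenspace threshold subcritical steady branches appear
  that linear theory does not see, whereas at `α ≥ 1` the theorem excludes every steady, periodic
  or chaotic state other than `ū` (token `steady-or-statistical-branches`, two dimensions). Cites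
  added to `evasions_known:` / `scope_caveats:` below. Literature state: the `searchd` full-text
  leg timed out (vector leg, arXiv, Crossref, zbMATH and galaxy reachable); a 2024–26 arXiv sweep
  ("anomalous dissipation" × Navier–Stokes) surfaced only finite-window or `ν`-dependent-force
  results (Johansson–Sorella arXiv:2409.03599; Li arXiv:2605.18126, stability of the Bruè–De Lellis
  two-and-a-half-dimensional construction under geometric perturbations; De Rosa–Park
  arXiv:2403.04668; Elgindi–Lopes Filho–Nussenzveig Lopes arXiv:2504.18523; Bardos–Boutros–Titi
  arXiv:2509.12432), none with a steady single-shell planar force, and Chen–Jia–Wei–Zhang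
  arXiv:2510.13181 (unforced Kolmogorov flow on a non-square torus, asymptotic-stability threshold
  `‖ω₀‖_{H³} ≪ ν^{1/3}`, transients on `0 < t ≤ 1/ν` — the finite-window side on which this
  `t → ∞` theorem is silent); Iudovich 1965 itself (acq-01938), Marchioro 1987 II (acq-00421),
  Foias–Jolly–Yang 2013 (acq-01694), Constantin–Foias–Manley 1994 (acq-01732), Dascaliuc–Foias–Jolly
  2005 (acq-01710) not held.

* Audit 2026-08-15, generation 12 (D-0021 barrier audit of the support file
  `GravestModeLaminarAttractorExcess`, appended; statements unchanged): CONFIRMED. Re-checked in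
  Lean: `Marchioro1986_globalAttraction_holds` and both named halves of the Excess file are theorems
  (axioms `propext`, `Classical.choice`, `Quot.sound`); the Excess file was re-read symbol by symbol
  (the weights `(4π²(|k|² - 1))⁺` of `enstrophyExcess` vanish exactly on `k = 0` and on the first
  shell, `λ₅ - λ₁ = 4π²` in `tail_le_enstrophyExcess`, (A.42) as quoted) — no discrepancy, nothing
  vacuous (half 1 inhabits the Leray–Hopf predicate for these data). No narrowing found: every
  technique-class token is either delivered by a theorem of the tree or fenced by a printed caveat
  below, and the non-printed audit claims carried in `evasions_known:` (drift-closed form,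
  time-dependent first-shell forces, the single-shell and band-limited pincer with anomaly-free
  transport of the third component, vertical-only forcing) were re-derived on paper once more, this
  time (a) keeping the mean momentum in the pincer — `(B(u,u), Au) = 0` on every flat 2-torus and
  `|Au|² - λ‖u‖² - λξ = Σ_k (λ_k - λ)²|û_k|² ≥ 0` hold whatever `∫u`, so `½ξ' ≤ -νλξ` needs no
  `HasZeroMean` — and (b) in the `limsup`-of-Cesàro-means semantics of `Turb.meanEnergy` /
  `Turb.meanDissipation` with `j`-dependent data: the scalar step uses only the time-integrated
  functional `∫₀¹ (h, w) dt`, continuous for the weak topology of `L²((0,1) × T²)` on bounded sets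
  and uniformly integrable under `E∫₀¹‖w‖² ≤ E`, so no ν-uniform `L^∞_t L²_x` bound on the third
  component is needed (none holds: at fixed `ν` only `‖w - ∫w‖ ≤ max(‖w₀ - ∫w₀‖, ‖h‖/(4π²ν))`).
  ONE PRINTED ANCHOR ADDED to the three-dimensional evasion, which it makes quantitative in the
  summit's own normalisation: direct numerical simulation of the gravest Kolmogorov force
  `g = F cos(z/L) e_x`, `L = 1`, on the periodic cube `L_box = 2π` ("Re ≡ UL/ν", `U` the amplitude
  of the mean profile `ū₁ = U cos(z/L)`, numerically close to monochromatic even when turbulent) reaches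
  a statistically steady turbulent state whose friction factor `f = FL/U²`, "equivalent also to the
  dissipation factor `f = 2εL/U³`", follows "`f = f₀ + b/Re`", "the fit … gives `f₀ = 0.124`", "for
  `Re ≳ 160`", with `u'_rms/U ≃ 0.54 ± 0.03`, `U_rms/U ≃ 1.10 ± 0.02` and dissipation factor
  "`β ≲ 0.05`, consistent but quite smaller than the bound `β_b ≃ 0.214`" (`β_b = π/√216`, quoted
  there from Rollin–Dubief–Doering 2011) [cite: MusacchioBoffetta2014, §2 and §3.1] — under the
  scaling `(F, L, ν) ↦ (1, 1, ν/√(FL³))` this is bounded `U` with `ε` bounded below at a FIXED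
  smooth steady force as `ν → 0`, i.e. the summit `Literature.Turb.ZerothLaw` observed numerically
  for the simplest force on `T³`, in the very configuration whose `y`-invariant reduction (planar
  flow in the `(x, z)`-plane driven by the first-shell force `F cos z e_x`, passive `u_y` with zero
  source) is laminar by the theorem of this file (mean-zero planar data; a drift state otherwise).
  Mathematically the laminar branch there is
  linearly stable at every `Re` [cite: VeenGoto2016, Abstract and §2.2] and every Leray–Hopf
  solution issued from rest IS the (smooth, global) unsteady laminar solution by weak–strong
  uniqueness, so the turbulent branch is reached only from data outside a basin of the laminar
  state — immaterial for the summit, whose data `u₀ⱼ` may depend on `j` and whose bounded-mean-energy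
  solutions live at time-averaged `L²`-distance `≍ ν_j⁻¹` from the laminar state `g/(ν_jλ₁)` in any
  case. Literature state:
  the `searchd` full-text leg timed out and OpenAlex / Semantic Scholar were rate-limited during the
  audit (arXiv, zbMATH, Crossref and the galaxy corpora reachable); a 2025–26 arXiv sweep surfaced
  nothing with a steady first-shell or single-shell planar force beyond the generation-11 list;
  Marchioro 1987 II (acq-00421; zbMATH 0617.76059 re-read: "An open set of external forces is
  presented, for which the stationary state remains attractive for any Reynolds number"),
  Foias–Jolly–Yang 2013 (acq-01694), Constantin–Foias–Manley 1994 (acq-01732), Dascaliuc–Foias–Jolly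
  2005 (acq-01710), Iudovich 1965 (acq-01938) still not held.
* Audit 2026-08-15, generation 13 (D-0021 barrier audit of the support file
  `GravestModeLaminarAttractorExcess`, appended; statements unchanged): CONFIRMED — and, after thirteen
  passes, SATURATED: every technique-class token is delivered by a theorem of the tree or fenced by a
  printed caveat below, and no modality tried so far (page re-reads, Lean re-checks, junk/degenerate
  instances, the non-printed audit claims re-derived in the summit's `limsup` semantics, arXiv/zbMATH/
  Crossref/galaxy sweeps, and now the citing graph) has produced a narrowing; further generations should
  be spent elsewhere unless one of the open acquisitions lands. Re-checked in Lean: both named halves of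
  the Excess file and `Marchioro1986_globalAttraction_holds` are theorems (axioms `propext`,
  `Classical.choice`, `Quot.sound`); FMRT PDF pp. 163–164 and 178–180 re-read against the Excess docstrings
  (two harmless print slips on p. 179/180 — `λ₅(‖u‖² - λ₁‖u‖²)` for `λ₁|u|²`, `lim |P₄u(t)| = 0` for
  `P₄v` — are rendered correctly in the tree). NEW MODALITY, no evasion: the citing graph of Marchioro 1986
  (`lit citing`, 111 works, every dated row triaged) splits into instability and bifurcation at forcing
  wavenumber `≥ 2` or aspect ratio `α < 1` (Liu, CMP 1992/1993 and CPDE 1992/1994 — lower bounds on the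
  attractor dimension, on the 3-torus of rectangular cross-section through Squire's transformation;
  Chen–Price 1996/1997/2005; Okamoto–Shōji 1993; Kim–Okamoto 2017), stochastic or kicked forcing
  (Majda–Wang 2005; Hairer–Mattingly 2004), data assimilation, flows on the sphere, and three corroborations:
  (i) the content of Foias–Jolly–Yang 2013 (acq-01694, unfulfilled for five generations) is available
  second-hand and is NOT an evasion — their single-mode programme "assume[s] ... that the force `g` is an
  eigenvector of the Stokes operator `A`, namely `Ag = λg`, where `λ ≥ 2κ₀²` ... In the case `λ = κ₀²`, the
  global attractor `𝒜` is reduced to a single point (see [Marchioro 1987]), hence there are no ghost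
  solutions" (non-stationary trajectories on `𝒜` with constant energy and enstrophy, for which
  `E = (g,u) = |Au|²/λ`; hypothetical, shown not to exist in "chained" form for `λ = 2κ₀²`)
  [cite: TianZhang2015, §1 p. 3, §3 Def. 1 and Prop. 1 (= Foias–Jolly–Yang 2013, Prop. 6.3), §8];
  (ii) a cross-system echo — for the gravest sinusoidal internal heat source in two dimensions the laminar
  `Nu ∼ Ra` branch is observed stable up to `Ra_Q ≈ 10¹¹`, `Re ≈ 4·10⁴`, "in a similar fashion to 2D flows
  forced at the largest scale [Marchioro]", while general sources and the 3-D no-slip problem are turbulent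
  [cite: MiquelEtAl2019, closing section] — the same 2-D-gravest / 3-D split as the THREE DIMENSIONS evasion
  below; (iii) steady states of a fixed Galerkin truncation at fixed force as `G → ∞` admit strict unitary
  expansions `v_n = v + Γ_{1,n}w₁ + …` in two and three dimensions (Hoang–Jolly et al., CPAA 2024 =
  arXiv:2308.15649, Thm. (thm1)), Marchioro's example being cited there as the exception to growing
  complexity — finite-dimensional, a neighbour only. Acquisitions filed this pass: Liu 1994 (acq-01967),
  Derks–Ratiu 1998 (families of stable stationary Euler states attract nearby Navier–Stokes solutions,
  which decay along them; acq-01968); Marchioro 1987 II re-requested (acq-00421, cite-only). Service state: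
  the `searchd` full-text leg timed out and OpenAlex / Semantic Scholar were rate-limited (Crossref, zbMATH,
  arXiv, galaxy and the citation graph reachable).
* Audit 2026-08-15, generation 15 (D-0021 barrier audit of the support file
  `GravestModeLaminarAttractorExcess`, appended; statements unchanged): CONFIRMED. Re-checked in
  Lean: both named halves of the Excess file and `Marchioro1986_globalAttraction_holds` are theorems
  (axioms `propext`, `Classical.choice`, `Quot.sound`); the summit `Literature.Turb.ZerothLaw` and the
  route file `Theses/TwoAndHalfD.lean` were re-read against `blocks:` (the barrier reaches the `T³`
  summit only through two-and-a-half-dimensional reductions and two-dimensional analogues, as stated).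
  The non-printed audit claims carried in `evasions_known:` were re-derived independently once more —
  the drift-closed form (co-moving frame; the pullback first-shell response is steady in the laboratory
  frame), the time-dependent first-shell extension (the `ξ`-pincer is unchanged, `|u(t)| ≤
  |u₀|e^{-νλ₁t} + sup|f|/(νλ₁)`, every term of `β(t)` carries a `Q₄v` factor and `∫_T^∞|β| → 0`), the
  single-shell two-and-a-half-dimensional blocking chain (pincer with the mean momentum kept; Krylov–
  Bogoliubov path measures on unit windows; Aubin–Lions tightness from `E∫‖v‖²_{H¹} ≤ λE`; the limit
  transport equation through strong × weak products; the DiPerna–Lions commutator with `v̄ ∈ L²_tH¹_x`,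
  `w̄ ∈ L²_{t,x}`; stationarity of the renormalised budget and truncation, `E∫∫h w̄ = 0`; uniform
  integrability of `∫₀¹(h, w)dt`) and the vertical-only-forcing bound of generation 9 (b) — no gap found.
  ONE GEOMETRIC CASE CLOSED EXPLICITLY (sharpening generation 9 (a), which exhibited only the rectangular
  quotient of the direction `(1,1,0)`): the two-and-a-half-dimensional reduction of `T³` along a
  primitive integer direction `d` lives on the flat 2-torus whose wave-vector lattice is `ℤ³ ∩ d^⊥`
  (velocity `u = v + w d̂`, `v ⊥ d`; derivatives along `d` vanish and `d·∇p = 0` by periodicity, so `v`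
  solves the 2-D equations on that torus and `w` is passive with source `f·d̂`); for the body diagonal
  `d = (1,1,1)` this lattice is the HEXAGONAL lattice `A₂`, whose first shell is the six vectors
  `±(1,-1,0)`, `±(0,1,-1)`, `±(1,0,-1)` (`|k|² = 2`, a six-dimensional real eigenspace: three-wave
  "hexagonal Kolmogorov" forces) and CONTAINS EQUAL-NORM TRIADS, `(1,-1,0) + (0,1,-1) = (1,0,-1)` — the
  one reduction of `T³` on which the square-lattice arithmetic behind "all three entries are
  eigenfunctions associated with the smallest eigenvalue" (tree: `freqNormSq_add_ne_one`;
  `freqNormSq_add_ne_of_eq` of the Lattice sibling) fails. The theorem and the blocking hold there all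
  the same, by the lattice-free identity of generation 3 made explicit: every single-shell field `w ∈ E_λ`
  of a flat 2-torus is a steady Euler flow (`w = ∇^⊥ψ`, `-Δψ = λψ`, `(w·∇)w = ∇(½|w|² + ½λψ²)`), so
  `B(w,w) = 0` in `H`, and by polarisation `P[B(φ,ψ) + B(ψ,φ)] = 0` for all `φ, ψ ∈ E_λ`: the trilinear
  form is ALTERNATING on `E_λ × E_λ × E_λ` (resonant triads may give `b(φ₁,φ₂,φ₃) ≠ 0`, but it vanishes
  as soon as two entries coincide), which is all that (A.32)–(A.34) and the first-shell ODE use —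
  `b(P₄v,P₄v,ū) = 0`, the `E_λ`-block of the linearisation about any `ū ∈ E_λ` is zero, and `E_λ` is
  invariant with LINEAR Stokes dynamics under `E_λ`-valued forcing. So planar forcing in the first shell
  of the hexagonal quotient is laminar for mean-zero data and drift-closed otherwise, and the single-shell
  pincer was lattice-free from the start: covered, for every direction `d`, as generation 9 (a) asserted.
  TWO PRINTED NEIGHBOURS, no evasion: (i) the disturbance form of the pincer survives linear drag `μ` and
  the `β`-effect — for Kolmogorov forcing `cos(x - x_f)` on the periodic square `2πL × 2πL` with `βψ_x`
  and drag `-μ∇²ψ`, "`½ d/dt (E_φ - Z_φ) = -μ(E_φ - Z_φ) - νZ_φ + νP_φ` … This cancellation is a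
  general property of flows forced by a single Helmholtz eigenmode" [cite: TsangYoung2008, §II.A eq. (10)],
  the basis of their energy–enstrophy stability method (op. cit. §V; the instabilities studied there are
  Floquet / long-wave, `L > 1`, i.e. forcing above the gravest mode of the box, Gill's inequality);
  (ii) the time-periodic neighbour, the "oscillating Kolmogorov flow" [cite: Frenkel1991] (paywalled,
  acq-02002, not read this pass): by the time-dependent form of the pincer (`scope_caveats:`, generation 3;
  Galerkin level in sibling `GravestModeLaminarAttractorTimePincer`) every Leray–Hopf solution on a flat
  torus whose gravest Stokes mode carries the oscillating force converges to the enslaved linear response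
  at every `ν`, so any instability found there must involve perturbation wavenumbers below the forcing one
  — recorded as a consistency test for when the paper arrives, not as a cite of its content. Literature
  state: the `searchd` full-text leg timed out (rc 75) throughout; arXiv, Crossref, zbMATH and the galaxy
  corpora reachable; none of acq-00421, acq-01694, acq-01710, acq-01732, acq-01938, acq-01967, acq-01968
  fulfilled (`open` / `cite-only`). Generation 13's verdict stands — SATURATED: spend further generations
  elsewhere unless an acquisition lands.
* Audit 2026-08-15, generation 16 (D-0021 barrier audit of the support file
  `GravestModeLaminarAttractorExcess`, appended; statements unchanged): CONFIRMED. Re-checked in Lean: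
  `Marchioro1986_globalAttraction_holds` and both named halves of the Excess file are theorems (one probe
  file, rc 0, axioms `propext`, `Classical.choice`, `Quot.sound`). The non-printed audit claims carried in
  `evasions_known:` (drift-closed form; time-dependent first-shell forces; the single-shell
  two-and-a-half-dimensional blocking chain — pincer in `limsup`-of-Cesàro semantics, Krylov–Bogoliubov laws
  along a realising sequence, Aubin–Lions for the planar flow, DiPerna–Lions with `p = q = 2` in space–time,
  stationarity of the renormalised scalar budget, uniform integrability of `∫₀¹(h, w)dt` from second
  moments; vertical-only forcing) were re-derived once more without finding a gap. NEW MODALITY this pass: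
  the local full-text index, unreachable in generations 7–15, answered single-term queries, and two held
  printed neighbours were read and cited (no evasion, no narrowing): (i) the Galilean drift family and the
  co-moving-frame reduction behind the GALILEAN DRIFT entry are printed for Kolmogorov forcing at every
  wavenumber, with drag and cross flow rate [cite: HirutaToh2018, eqs. (1)–(4), (14) and closing discussion]
  — the convergence of every solution to the drift state (the drift-closed theorem) remains an audit claim;
  (ii) in two dimensions, too, a Kolmogorov flow that is linearly stable at every Reynolds number need not be
  globally attracting once the forced mode is not the gravest one: second-harmonic forcing of a `1 : 2` box
  carries eight disconnected steady states born in a saddle-node bifurcation at `R ≈ 13.25`, some stable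
  with measured basins [cite: Evstigneev2021, §3.3 and §4] — the hypothesis `Af = λ₁f` of the theorem, not
  linear stability, is what excludes competing states (cf. THREE DIMENSIONS, van Veen–Goto). Acquisitions
  acq-00421, acq-01694, acq-01710, acq-01732 (`cite-only`) and acq-01938, acq-01967, acq-01968, acq-02002
  (`open`) unchanged. Verdict of generations 13/15 reaffirmed: SATURATED — no statement of this file or of
  the Excess file changes; rotate the audit elsewhere unless an acquisition lands.

## References

* C. Marchioro, Comm. Math. Phys. 105 (1986) 99–106, Theorem and (4)–(12), Remark and Note added
  in proof (p. 106).
* C. Marchioro, *An example of absence of turbulence for any Reynolds number: II*, Comm. Math.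
  Phys. 108 (1987) 647–651 (short torus, `R`-independent open set of forces; not held, acq-00421).
  [`Marchioro1987`]
* C. Foias, O. Manley, R. Rosa, R. Temam, *Navier–Stokes Equations and Turbulence* (CUP 2001),
  Ch. III §3.1, (3.31)–(3.35) (PDF pp. 163–164) and Appendix III.A.4 (PDF pp. 178–180).
* P. Constantin, C. Foias, R. Temam, Physica D 30 (1988) 284–296 (the proof presented in FMRT).
* A. Alexakis, C. R. Doering, Phys. Lett. A 359 (2006) (general 2-D forcing: companion barrier
  `AlexakisDoering2006_energyDissipationBound`).
* L. van Veen, S. Goto, *Sub critical transition to turbulence in three-dimensional Kolmogorov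
  flow*, Fluid Dyn. Res. 48 (2016) 061425 = arXiv:1512.02570, Abstract and §2.2. [`VeenGoto2016`]
* S. Musacchio, G. Boffetta, *Turbulent channel without boundaries: the periodic Kolmogorov flow*,
  Phys. Rev. E 89 (2014) 023004 = arXiv:1401.5935, §2 (friction and dissipation factors, momentum
  budget `f = σ + 1/Re`) and §3.1 (`f = f₀ + b/Re`, `f₀ = 0.124` for `Re ≳ 160`; `β ≲ 0.05`):
  gravest-mode forcing of the periodic cube is numerically turbulent with `Re`-independent friction
  factor (audit 2026-08-15, gen 12). [`MusacchioBoffetta2014`]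
* L. D. Meshalkin, Ia. G. Sinai, J. Appl. Math. Mech. 25 (1961) 1700–1705. [`MeshalkinSinai1961`]
* V. I. Iudovich, J. Appl. Math. Mech. 29 (1965) 527–544 (loss of stability and secondary flows for
  `α < 1`; global stability for every `R` when `α ≥ 1`, as reported in Okamoto–Shōji 1993, Thm. 3.1;
  paper not held, acq-01938). [`Iudovich1965`]
* H. Okamoto, M. Shōji, *Bifurcation diagrams in Kolmogorov's problem of viscous incompressible fluid
  on 2-D flat tori*, Japan J. Indust. Appl. Math. 10 (1993) 191–218 (read in the RIMS Kôkyûroku 767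
  (1991) 29–51 version: §2 p. 31; §3 Prop. 3.1, Lemma 3.1, Thm. 3.1 (Iudovich) and Remark, pp. 32–34;
  §4 p. 36). [`OkamotoShoji1993`]
* G. J. Chandler, R. R. Kerswell, J. Fluid Mech. 722 (2013) 554–595 = arXiv:1207.4682, §4.1.
  [`ChandlerKerswell2013`]
* Z.-M. Chen, W. G. Price, *Long-time behavior of Navier–Stokes flow on a two-dimensional torus
  excited by an external sinusoidal force*, J. Stat. Phys. 86 (1997) 301–335, p. 301 (`k = 1`:
  global stability for all Reynolds numbers, after Meshalkin–Sinai and Marchioro). [`ChenPrice1997`]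
* M. Hairer, J. C. Mattingly, *Ergodic properties of highly degenerate 2D stochastic Navier–Stokes
  equations*, C. R. Math. Acad. Sci. Paris 339 (2004) 879–882, Prop. 1.1 (forced modes must
  contain two of unequal length). [`HairerMattingly2004`]
* R. J. DiPerna, P.-L. Lions, Invent. Math. 98 (1989) 511–547, Lemma II.1 (commutator estimate
  used in the gen-4 and gen-6 audit remarks).
* P. Constantin, C. Foias, O. P. Manley, *Effects of the forcing function spectrum on the energy
  spectrum in 2-D turbulence*, Phys. Fluids 6 (1994) 427–429 (single-scale forcing: no
  Kraichnan–Leith–Batchelor range on the attractor; paywalled, acq-01732). [`ConstantinFoiasManley1994`]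
* C. V. Tran, T. G. Shepherd, Physica D 165 (2002) 199–212 = arXiv:nlin/0201002, §4: the
  dynamical constraint `‖u‖₁² ≤ λ_s‖u‖²` on the attractor for monoscale forcing `f ∈ H(λ_s)`,
  `λ_s > λ₁`, time dependence immaterial (Remark after (constraint)). [`TranShepherd2002`]
* M. Bagnara, D. W. Boutros, C. De Lellis, S. Mayboroda, *Regularity thresholds for anomalous
  dissipation and related phenomena in passive scalars*, arXiv:2603.11466 (2026), §2.1 and Thm. 3.1
  (renormalisation property ⇒ no scalar dissipation anomaly, strong convergence). [`BagnaraEtAl2026`]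
* R. Dascaliuc, C. Foias, M. S. Jolly, J. Differential Equations 248 (2010) 792–819, §1 ("force
  in a single eigenspace of the Stokes operator … known not to be turbulent"); J. Dynam.
  Differential Equations 17 (2005) 643–736 (the attractor in the energy–enstrophy plane;
  acq-01710). [`DascaliucFoiasJolly2010`, `DascaliucFoiasJolly2005`]
* C. Foias, M. S. Jolly, M. Yang, *On single mode forcing of the 2D-NSE*, J. Dynam. Differential
  Equations 25 (2013) 393–433 (acq-01694). [`FoiasJollyYang2013`]
* A. Alexakis, C. R. Doering, Phys. Lett. A 359 (2006) = arXiv:physics/0605090, §4 (monochromatic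
  forcing, steady or time dependent: `χ = k_f²ε`, `ε ≤ νk_f²U²`, `χ ≤ νk_f⁴U²`).
* P. Constantin, A. Tarfulea, V. Vicol, *Absence of anomalous dissipation of energy in forced two
  dimensional fluid equations*, Arch. Ration. Mech. Anal. 212 (2014) 875–903 = arXiv:1305.7089,
  §1–§2 (Kolmogorov forcing at any Stokes eigenvalue: `B(u,u) = 0` on single shells, steady
  bounded-energy families → steady forced Euler states, the trajectory-wise constraint
  `δ' + 2νμδ ≤ 0` and the ν-uniform `H¹` bound (enst)), §6 Thm. 3 (stationary statistical
  solutions from Banach limits of time averages). [`ConstantinTarfuleaVicol2013`]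
* J. Tian, B. S. Zhang, *On solutions of the 2D Navier–Stokes equations with constant energy and
  enstrophy*, Indiana Univ. Math. J. 64 (2015) 1725–1767 = arXiv:1507.01142, §1 p. 3 (single-mode
  forcing `Ag = λg`, `λ ≥ 2κ₀²`; `λ = κ₀²`: attractor a point, after Marchioro), §3 Def. 1 / Prop. 1
  (= Foias–Jolly–Yang 2013, Prop. 6.3), §8 (audit 2026-08-15, gen 13). [`TianZhang2015`]
* B. Miquel, S. Lepot, V. Bouillaut, B. Gallet, *Convection driven by internal heat sources and sinks:
  heat transport beyond the mixing-length or "ultimate" scaling regime*, Phys. Rev. Fluids 4 (2019)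
  121501(R) = arXiv:2010.11507, closing section (gravest-mode source: laminar branch stable to
  `Ra_Q ≈ 10¹¹`, "in a similar fashion to 2D flows forced at the largest scale"; audit gen 13).
  [`MiquelEtAl2019`]
* V. X. Liu, *Remarks on the Navier–Stokes equations on the two and three dimensional torus*, Comm.
  Partial Differential Equations 19 (1994) 873–900 (attractor-dimension lower bounds; 3-torus via
  Squire's transformation; zbMATH review; paywalled, acq-01967). [`Liu1994`]
* L. Hoang, M. S. Jolly et al., *On Galerkin approximations of the Navier–Stokes equations in the limit
  of large Grashof numbers*, Commun. Pure Appl. Anal. (2024) = arXiv:2308.15649, §1 and Thm. (thm1).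
* Y.-K. Tsang, W. R. Young, *Energy–enstrophy stability of β-plane Kolmogorov flow with drag*, Phys.
  Fluids 20 (2008) 084102 = arXiv:0803.0558, §II.A eqs. (8)–(10) (single-eigenmode cancellation with drag
  and `β`), §V (the energy–enstrophy method) (audit 2026-08-15, gen 15). [`TsangYoung2008`]
* A. L. Frenkel, *Stability of an oscillating Kolmogorov flow*, Phys. Fluids A 3 (1991) 1718–1729
  (time-periodic neighbour; paywalled, acq-02002; audit 2026-08-15, gen 15). [`Frenkel1991`]
* Y. Hiruta, S. Toh, *Subcritical laminar–turbulence transition with wide domains in simple two-dimensional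
  Navier–Stokes flow without walls*, arXiv:1805.04257 (2018), eqs. (1)–(4) (Kolmogorov forcing with drag `γ`
  and cross flow rate `U_y`; the drifting laminar state), (13)–(14) (long-wave neutral curve; linear
  stability at every `Re` for `|U_y| > (2n²)^{-1/4}`), closing discussion ("the forcing term is
  `sin(n(y - U_yt))` in this frame") (audit 2026-08-15, gen 16). [`HirutaToh2018`]
* N. M. Evstigneev, *Disconnected stationary solutions for 2D Kolmogorov flow problem in periodic domain*,
  J. Phys.: Conf. Ser. 1730 (2021) 012078, §2 (`Ω(α) = [0, 2π/α] × [0, 2π]`, force `sin(βy)`, zero-mean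
  gauge, deflated pseudo-arc-length continuation with `N = 512`), §3.3 (`α = β = 2`: main flow linearly
  stable for all `R`, eight disconnected steady states from a saddle-node at `R = 13.2466`, multistability
  with basins for `16.725 ≤ R ≤ 20.665`), §4 (audit 2026-08-15, gen 16). [`Evstigneev2021`]
-/

open MeasureTheory Set Filter Topology
open scoped ENNReal NNReal

noncomputable section

namespace Literature.Barriers.AnomalousDissipation

/-- The flat two-torus `T² = (ℝ/ℤ)²` (local notation). -/
local notation "𝕋²" => UnitAddTorus (Fin 2)
/-- Velocity values on `T²` (local notation). -/
local notation "E²" => EuclideanSpace ℝ (Fin 2)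

/-- **The first-mode force (3.31) of Foias–Manley–Rosa–Temam** on the unit torus `T²`:
`f_α(x) = α√2 sin(2π x₀) e₁` (`x₀` the first coordinate, `e₁` the second basis vector), an
eigenfunction of the Stokes operator for the first eigenvalue `λ₁ = 4π²` with `(f·∇)f = 0`
(FMRT 2001, Ch. III (3.31)–(3.33); Marchioro 1986, (5) with `f₁ = 0` is a four-parameter
variant in the same Fourier shell). Written as the accepted real Stokes eigenfield
`Torus.stokesMode k a false = (x ↦ Im e^{2πi k·x} a)` with `k = (1,0)`, `a = α√2 e₁`. [cite: FoiasManleyRosaTemam2001, Ch. III (3.31)] -/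
def marchioroForce (α : ℝ) : 𝕋² → E² :=
  Literature.Analysis.FluidPDE.Torus.stokesMode (Pi.single 0 1) ((α * Real.sqrt 2) • EuclideanSpace.single 1 1) false

/-- **The laminar fixed point (3.34)**: `ū = f/(νλ₁) = (4π²ν)⁻¹ f_α` on the unit torus
(`λ₁ = 4π²`), an exact steady solution of the forced 2-D Navier–Stokes equations since
`νAū = f` and `B(ū,ū) = 0` (FMRT 2001, Ch. III (3.34); Marchioro 1986, (12)). [cite: FoiasManleyRosaTemam2001, Ch. III (3.34)] -/
def marchioroLaminarState (α ν : ℝ) : 𝕋² → E² :=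
  (4 * Real.pi ^ 2 * ν)⁻¹ • marchioroForce α

/-- The first-mode force is continuous (it is a real Stokes eigenfield). [folklore] -/
theorem marchioroForce_continuous (α : ℝ) : Continuous (marchioroForce α) :=
  (Literature.Analysis.FluidPDE.Torus.stokesMode _ _ _).continuous

/-- The laminar state is continuous. [folklore] -/
theorem marchioroLaminarState_continuous (α ν : ℝ) : Continuous (marchioroLaminarState α ν) :=
  (marchioroForce_continuous α).const_smul _

/-- Unfolding lemma for `marchioroLaminarState`. [folklore] -/
theorem marchioroLaminarState_apply (α ν : ℝ) (x : 𝕋²) :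
    marchioroLaminarState α ν x = (4 * Real.pi ^ 2 * ν)⁻¹ • marchioroForce α x :=
  rfl

/-- **Marchioro's theorem / triviality of the attractor with force in the first mode**
(Marchioro, CMP 105 (1986), Theorem; Foias–Manley–Rosa–Temam 2001, Ch. III (3.35) with
Appendix III.A.4, after Constantin–Foias–Temam 1988). For every `α`, every viscosity
`ν > 0` — hence every Grashof/Reynolds number — every datum `u₀ ∈ H` (`u₀ ∈ L²(T²)`, weakly
divergence free, mean zero) and every global Leray–Hopf solution `u` of the two-dimensional
Navier–Stokes equations on the unit torus `T²` with viscosity `ν` and the steady first-mode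
force `f_α = marchioroForce α`, the solution converges in `L²` to the laminar fixed point
`ū = f_α/(4π²ν)`: `‖u(t) - ū‖_{L²(T²)} → 0` as `t → ∞` ("the global attractor consists only
of `ū`"; Marchioro: "a stable stationary state which attracts exponentially each solution",
"for any Reynolds number").

BARRIER (D-0021):
- technique_class: two-dimensional first-mode-forcing kolmogorov-type-forcing large-grashof steady-or-statistical-branches two-and-a-half-dimensional-base-flows
- blocks: every two-dimensional reading of `Literature.Turb.ZerothLaw` = `AnomalousDissipation` (fixed smooth steady force, `ν_j → 0`, bounded mean energy, mean dissipation bounded below) whose force is a first-eigenvalue Stokes eigenfunction with `B(f,f) = 0`, and the 2-D base flow `v_j` of `x₃`-invariant witnesses (route TwoAndHalfD, cruxes TwoDBoundedEnergy / ScalarAnomalySteadySource) driven by such a horizontal force, FOR MEAN-ZERO DATA (`HasZeroMean u₀`, as in the `def` below; the summit and these cruxes as typed put no mean condition on the data — audit 2026-08-15, see `scope_caveats:` and `evasions_known:`): all Leray–Hopf solutions converge to `ū = f/(νλ₁)` [cite: FoiasManleyRosaTemam2001, Ch. III (3.35) and App. III.A.4] [cite: Marchioro1986, Theorem], so the long-time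 state is laminar with `|ū|_{L²} = |f|_{L²}/(νλ₁)` — unbounded energy as `ν → 0` at fixed `f ≠ 0`, dissipation `ν‖ū‖² = |f|²/(νλ₁)`, `β ∝ Re⁻¹` — and "we may have `G` arbitrarily large, yet the global attractor may be reduced to a single point" [cite: FoiasManleyRosaTemam2001, Ch. III §3.1]; the stability persists for forces in a neighbourhood of `f₀` (size depending on `R`) [cite: Marchioro1986, Theorem].
- because: `ū = f/(νλ₁)` is an exact steady solution since `Af = λ₁f`, `B(f,f) = 0` [cite: FoiasManleyRosaTemam2001, Ch. III (3.32)–(3.34)]; subtracting `λ₁ ×` the energy identity from the enstrophy identity kills the forcing (`(f,Au) = λ₁(f,u)`) and gives `½ d/dt(‖u‖² - λ₁|u|²) + νλ₅(‖u‖² - λ₁|u|²) ≤ 0`, so the component `Q₄u` off the first eigenspace decays [cite: FoiasManleyRosaTemam2001, App. III.A.4 (A.32)–(A.34)]; on the first eigenspace the trilinear term vanishes, `b(P₄v,P₄v,ū) = 0` "because all three entries are eigenfunctions associated with the smallest eigenvalue", leaving `½ d/dt|P₄v|² + νλ₁|P₄v|² = β(t) → 0` [cite: FoiasManleyRosaTemam2001,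 App. III.A.4].
- evasions_known: (audit 2026-08-15) GALILEAN DRIFT — for data of mean momentum `c = ∫u₀` with `c₀ = c·k ≠ 0` (`k = (1,0)` the wave vector of `f_α`) the force admits the explicit steady states `marchioroDriftState α ν c = c + (a sin 2πx₀ + b cos 2πx₀) e₁`, `a = α√2ν/(c₀²+4π²ν²)`, `b = -α√2c₀/(2π(c₀²+4π²ν²))` (the `2 × 2` steady system and `a² + b² = 2α²/(4π²(c₀²+4π²ν²))` are proved below, `driftCoeff_steady_system`, `sq_add_sq_driftCoeff`), whose energy `|c|² + α²/(4π²(c₀²+4π²ν²))` stays BOUNDED as `ν → 0` at fixed `α` (`norm_marchioroDriftState_sub_le`: oscillation `≤ |α|/|c₀|` uniformly in `ν`) while `ν‖∇v‖² = ∫⟪f_α,v⟫ = να²/(c₀²+4π²ν²) → 0` (force and response in quadrature); by the Galilean reduction [cite: FoiasManleyRosaTemam2001, Ch. II (2.6)–(2.9)] these are the long-time states of ALL Leray–Hopf solutions with mean `c` (audit claim: the translated force `f_α(x + ct)` stays in the first eigenspace, so (A.32)–(A.34) and the first-shell ODE of App. III.A.4 go through verbatim; not printed as such — (audit 2026-08-15,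 gen 16) but the drift family and the reframing are printed for Kolmogorov forcing `sin(ny)x̂` at every `n`, with linear drag `γ ≥ 0` and cross flow rate `U_y`: the global laminar state is `(Re/D) sin(ny + θ) x̂ + U_y ŷ`, `tan θ = ReU_yn/(n² + γ)`, `D² = (n² + γRe)² + (nReU_y)²` — at `γ = 0`, `n = 1` the state `marchioroDriftState` in Kolmogorov's normalisation, amplitude `Re/√(1 + Re²U_y²) ≤ U_y⁻¹` — because "the `y` dependence of the external force breaks Galilean invariance in `y`, the flow rate `U_y` is a control parameter of the system", "the amplitude of the laminar flow has an upper bound proportional to `U_y⁻¹`" and "`U_y` can be interpreted as an advection speed of a weak disturbance in the frame of zero flow rate: the forcing term is `sin(n(y - U_yt))` in this frame" [cite: HirutaToh2018, eqs. (1)–(4), (14) and closing discussion]; their subcritical turbulence lives at `n = 4` in long boxes `1/α = 64, 256` with drag `γRe = 30` and `U_y = 0.5 > U_y^c(4)`, `U_y^c(n) = (2n²)^{-1/4}` being the flow rate beyond which the drifting laminar state is linearly stable at every `Re` by their long-wave neutral curve (14) — outside the theorem on every count, and one more instance of "linearly stable at every `Re`, not globally attracting"), so the drift evades the *bounded-energy*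 consequence — crux `TwodBoundedEnergy` (stmt-AnomalousDissipation-0209) is witnessed AS TYPED by `g = f_1` with drifting data — but not the zeroth law: on first-shell-plus-mean states `‖∇v‖² = 4π²‖v - c‖²`, so dissipation `≤ 4π²ν ×` energy `→ 0`; (audit 2026-08-15, gen 4) nor does the drift open the `x₃`-invariant (two-and-a-half-dimensional) door through the transported third component `w`, `∂ₜw + v·∇w = νΔw + h` with the steady smooth mean-zero source `h = f₃`: bounded planar energy keeps `c` bounded and (for `α ≠ 0`) `c₀` away from `0`, so along a subsequence the drift states `v_ν = c + φ_ν(x₀)e₁` — on which the planar flow settles in `H¹` at fixed `ν` — converge in `C¹` to the smooth steady field `v₀ = c + b₀cos(2πx₀)e₁`, `b₀ = -α√2/(2πc₀)` (smoothly conjugate to the Kronecker flow `(c₀,c₁)` through `y ↦ y - Φ(x₀)/c₀`, `Φ' = b₀cos 2πx₀`); at fixed `ν` the scalar relaxes in `L²` to the steady response `w_ν`, `ν‖∇w_ν‖² = (h, w_ν)`, and the long-time means follow; if the scalar variance `‖w_ν‖²_{L²}` stays bounded, every weak limit `w̄` solves `v₀·∇w̄ = h` in `𝒟'` and is renormalised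 (`v₀ ∈ W^{1,∞}`, DiPerna–Lions commutator estimate in `L²`), whence `(h, w̄) = (v₀·∇w̄, w̄) = 0` and the scalar dissipation `(h, w_ν) → 0` along the whole sequence — bounded mean energy and a dissipation floor are incompatible in the entire `x₃`-invariant class with steady first-shell planar forcing, WHATEVER THE DATA (audit claim, elementary, not printed; it does not cover the time-dependent first-shell stirring of idea card `first-shell-enslaving-dichotomy`, whose limit stirrer need not be autonomous); THREE DIMENSIONS — for the gravest-mode Kolmogorov force on the periodic cube the laminar state is linearly stable at every Reynolds number, yet turbulence is sustained and a second equilibrium branch is born in a saddle-node bifurcation at finite `Re` (subcritical transition) [cite: VeenGoto2016, Abstract and §2.2], and (audit 2026-08-15, gen 12) the turbulent branch carries the zeroth law numerically: DNS of `F cos(z/L) e_x`, `L = 1`, on the periodic cube `2π` gives a friction factor `f = FL/U² = 2εL/U³ = f₀ + b/Re` with `f₀ = 0.124` for `Re ≳ 160` (dissipation factor `β ≲ 0.05`), i.e. bounded `U` with `ε` bounded below at fixed force under the scaling `ν ↦ ν/√(FL³)` [cite: MusacchioBoffetta2014, §3.1] — so the statement does not lift to `T³` (there every Leray–Hopf solution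 issued from rest is the laminar one by weak–strong uniqueness: the turbulent branch needs data outside its basin, which the summit's `j`-dependent data allow); HIGHER SHELLS — for Kolmogorov forcing `sin(ny)`, `n ≥ 2`, on the square torus the laminar state is linearly unstable at finite `Re` [cite: MeshalkinSinai1961, Thm.] [cite: ChandlerKerswell2013, §4.1] (`n = 4`: `Re_lin = 9.9669`, turbulent regime beyond) with bifurcating secondary flows [cite: Iudovich1965, Thm. 1] — (audit 2026-08-15, gen 11) in the aspect-ratio variable the dichotomy is printed and sharp: on the rectangular torus `T_α = [-π/α, π/α] × [-π, π]` Kolmogorov's single-mode force `∝ cos y` is globally, exponentially attracting for EVERY `R` if `α ≥ 1`, i.e. iff it is the gravest mode (Iudovich 1965; perturbation stream function in `H⁴(T_α)/ℝ`, zero-mean velocity) [cite: OkamotoShoji1993, §3 Thm. 3.1 (Iudovich) and Remark], while for every `α < 1` stability is lost on the neutral curve `R = R*(α)`, `R*` increasing, `R*(α) → √2` (`α → 0`), `R*(α) → +∞` (`α → 1`) [cite: OkamotoShoji1993, §3 Lemma 3.1], with subcritical non-laminar steady states below `R*(α)` for `α` close to `1` (numerics) [cite: OkamotoShoji1993, §4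 p. 36] — (audit 2026-08-15, gen 16) and LINEAR STABILITY AT EVERY `R` IS NO SUBSTITUTE for the first-eigenspace hypothesis even in two dimensions: for `sin(βy)x̂`, `β = 2`, on `Ω(α) = [0, 2π/α] × [0, 2π]` with `α = 2` (forced eigenvalue `4`; gravest eigenvalue `1`, carried by the subharmonics `(0, ±1)`; equivalently Kolmogorov's `sin y'` in the box `2π × 4π`, two forcing wavelengths high) "one can prove that the main trivial solution remains linearly stable on the positive real line", yet deflated arc-length continuation (`N = 512` harmonics) finds "eight additional solutions … formed by a … saddle-node bifurcation at `R = 13.2466 ± 0.005`", "disconnected from the main branch", some linearly stable with basins of attraction measured for `16.725 ≤ R ≤ 20.665`: "the 2D Kolmogorov flow problem contains disconnected multistable stationary solutions" [cite: Evstigneev2021, §3.3 and §4] — the two-dimensional counterpart of the subcritical `T³` scenario above (single-shell forced, so these states still obey `‖u‖² ≤ λ|u|²` and, at bounded energy, dissipation `≤ νλE`) — (audit 2026-08-15, gen 6) but HIGHER SINGLE SHELLS DO NOT EVADE IN 2½-D: instability of the laminar state is not the question the summit asks; for a force in any single Stokes eigenspace `E_λ` the printed dynamical constraint `‖u‖²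 ≤ λ|u|²` on the attractor [cite: TranShepherd2002, §4 (constraint)] (`½ξ' + νλξ ≤ 0` for `ξ = ‖u‖² - λ|u|²`, from `(f, Au) = λ(f, u)` and `(B(u,u), Au) = 0`; the time dependence of an `E_λ`-valued force is immaterial [cite: TranShepherd2002, §4 Remark]) and its mean form `ε ≤ νk_f²U²`, `χ = k_f²ε ≤ νk_f⁴U²` [cite: AlexakisDoering2006, §4] — (audit 2026-08-15, gen 8) printed also trajectory-wise and ν-uniformly, `δ' + 2νμδ ≤ 0`, `sup_{ν,t}‖u‖² ≤ λE + δ₊(0)` for Kolmogorov forcing `Af = λf` at any eigenvalue, steady branches included (`|Au|² = λ‖u‖² ≤ λ²E`) [cite: ConstantinTarfuleaVicol2013, §2 (diffeq)–(enst) and (h2bal)–(stbounds)], time-dependent shell-valued coefficients and the quantitative cap `ξ ≤ max(ξ(0), D/(νλ))` by the injection defect `D` proved at the Galerkin level in sibling `GravestModeLaminarAttractorTimePincer` — keep the planar flow of an `x₃`-invariant witness ν-uniformly bounded in `H¹` (in mean even in `H²`) at bounded energy, with planar dissipation `O(ν)`; in the vanishing-viscosity limit of the stationary statistics the transported third component is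 advected by an `L²_t H¹_x` field, its transport equation is renormalised [cite: DiPernaLions1989, Lemma II.1] and stationarity of the renormalised scalar budget forces `⟨(h, w)⟩ → 0`, i.e. vanishing scalar dissipation: NO zeroth law in the `x₃`-invariant class whenever the planar force is single-shell — whatever the shell, the data and the steady source `h` (audit claim assembling two printed facts, details in the header note of generation 6; design rule for route TwoAndHalfD: planar forcing with at least two shell radii — (audit 2026-08-15, gen 7) necessary, not sufficient: for a band-limited steady planar force `g = ∑ g_k` (shells `λ_min ≤ λ_k ≤ λ_max`) the time-mean constraint `⟨‖v‖²⟩ ≤ λ_max⟨|v|²⟩` persists whenever the injection is monoscale-like in time mean, `∑_k(λ_max - λ_k)⟨(v, g_k)⟩ ≥ 0` [cite: TranShepherd2002, §4 closing paragraphs], which again gives ν-uniform mean `H¹` bounds and renormalised, anomaly-free transport of the third component [cite: BagnaraEtAl2026, Thm. 3.1]; a witness therefore needs the planar flow to do NEGATIVE mean work on the lower forced shells, `∑_{λ_k<λ_max}(λ_max - λ_k)⟨(v_j, g_k)⟩ ≤ -c_jν_j` with `c_j → ∞` — the steady force must "inject energy at higher wavenumbers and remove energy at lower" ones [cite: TranShepherd2002,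 §1] (after Constantin–Foias–Manley 1994); weighted balance with the injection defect proved at the Galerkin level in sibling `GravestModeLaminarAttractorBandPincer`); towards a two-dimensional zeroth law itself none is published (for general steady 2-D forcing the energy dissipation is `O(Re^{-1/2})` at bounded energy [cite: AlexakisDoering2006, §2], companion barrier `AlexakisDoering2006_energyDissipationBound`); the rigidity is specific to first-shell forces — (audit 2026-08-15, gen 3) up to Marchioro's PRINTED NEIGHBOURHOOD: `f = f₀ + f₁` is admissible when `r₁ = ‖f₁‖²_{L²}/ν² < ε₁(R₀)` and `r₂ = ‖curl f₁‖²_{L²}/ν² < ε₂(R₀)` [cite: Marchioro1986, (7)–(9) and Theorem], an `O(ν)`-neighbourhood that is empty in the limit `ν → 0` at fixed `f₁ ≠ 0` ("Of course this does not exclude that for fixed `f ≠ f₀` and large `R` chaotic motion may appear" [cite: Marchioro1986, p. 106]); on the SHORT torus `[0,L] × [0,2π]`, `L < 2π` (not the tree's square `T²`), "a set of attractive stationary states of size and radius of attraction independent of `R`" is announced [cite: Marchioro1986, Note added in proof] and is the subject of Part II, an open set of forces whose stationary state "remains attractive for any Reynolds number" [cite: Marchioro1987, zbMATH review 0617.76059;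 paper not held, acq-00421] — for general forces only upper bounds `dim 𝒜 ≤ c G^{2/3}(1 + log G)^{1/3}` on the attractor are available [cite: FoiasManleyRosaTemam2001, Ch. III (3.29)–(3.30)].
- scope_caveats: MEAN-ZERO DATA is essential both to `u(t) → ū` and to "unbounded energy as `ν → 0`" (Marchioro (2)–(3): `∫u dx = 0`; FMRT: `u₀ ∈ H = Ḣ_per`) [cite: Marchioro1986, (2)–(3)] — the tree's Leray–Hopf notion does not impose it (`Torus.IsWeakNSSolutionForcedOn`: "Mean zero is not imposed"), hence neither do `Literature.Turb.ZerothLaw` nor the cruxes 0206/0209/0448 of route TwoAndHalfD, whose drifting readings are governed by the exact steady drift states `marchioroDriftState` instead (audit 2026-08-15; proved algebra below); the technique-class token `kolmogorov-type-forcing` means forcing wavenumber `n = 1` on the square or "short" (`L ≤ 2π`) torus only [cite: Marchioro1986, Remark p. 106] as far as LAMINARITY is concerned (for the zeroth-law blocking in the `x₃`-invariant class every single forced shell is covered, audit gen 6, and every band-limited planar force with non-negative lower-shell mean work, audit gen 7 — see `evasions_known:`); two space dimensions, periodic box with equal periods, force exactly in the first eigenspace with `B(f,f) = 0` (FMRT)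 or Marchioro's `f₀` plus a perturbation small in terms of `R` [cite: Marchioro1986, Theorem, (4)–(9)]; (audit 2026-08-15, gen 3) the printed proof uses of the force only `(f, Au) = λ₁(f, u)` and of the first shell only that `B(w,w) = 0` in `H` for single-shell `w` [cite: FoiasManleyRosaTemam2001, App. III.A.4 (A.32)–(A.34)], so (A.32)–(A.34) and the first-shell ODE go through verbatim for a bounded measurable TIME-DEPENDENT first-shell-valued force `f(t)` (the first-shell dynamics is then slaved to the linear response `ȧ + νλ₁a = f(t)`; a first-shell force oscillating at fixed frequency thus yields BOUNDED energy and vanishing dissipation as `ν → 0`, like the drift states) and on every flat torus `ℝ²/Λ` for forces in its first Stokes eigenspace (Marchioro's `L ≤ 2π` is the condition that his fixed force lies there [cite: Marchioro1986, Remark p. 106]) — audit observations, not printed as such (idea card `first-shell-enslaving-dichotomy` for the time-dependent case), except the steady RECTANGULAR case, which is Iudovich's 1965 theorem: global exponential stability for all `R` on `T_α`, `α ≥ 1` (perturbation stream function in `H⁴(T_α)/ℝ`, zero-mean velocity), "rediscovered" by Marchioro in slightly greater generality (audit 2026-08-15, gen 11) [cite: OkamotoShoji1993, §3 Thm. 3.1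 (Iudovich) and Remark]; the `def` below is the steady, square, (3.31) case only; nothing is asserted about three-dimensional forcing at the gravest mode or about the summit `Literature.Turb.ZerothLaw` on `T³` itself; about forces at higher shells the `def` says nothing and LAMINARITY fails there, but (audit 2026-08-15, gen 6) the enstrophy–energy pincer behind (A.32) survives for every single Stokes eigenspace as the dynamical constraint `‖u‖² ≤ λ|u|²` [cite: TranShepherd2002, §4 (constraint)] and carries the two-and-a-half-dimensional blocking to all single-shell planar forces (see `evasions_known:`; spectral core `shellPincer_spectral` below); the theorem is a `t → ∞` statement at fixed `ν` — relaxation rates `2νλ₅` off the first shell ((A.32)) and `νλ₁` on it, i.e. times `≳ 1/(8π²ν)` — and is silent about fixed windows `[0, T]` as `ν → 0`; rendering: unit torus (`L = 1`, `λ₁ = 4π²`), the specific force (3.31), convergence without Marchioro's exponential rate, Leray–Hopf solutions (unique in 2-D) for "every solution".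
- status: established (theorem) [cite: Marchioro1986, Theorem] [cite: FoiasManleyRosaTemam2001, Ch. III (3.35)] [cite: OkamotoShoji1993, §3 Thm. 3.1 (Iudovich)] -/
def Marchioro1986_globalAttraction : Prop :=
  ∀ (α ν : ℝ) (_hν : 0 < ν) (u₀ : 𝕋² → E²) (_hu₀ : MemLp u₀ 2 volume)
    (_hdiv : Literature.Analysis.FunctionSpaces.Torus.IsWeaklyDivFree u₀) (_hmean : Literature.Analysis.FunctionSpaces.Torus.HasZeroMean u₀) (u : ℝ → 𝕋² → E²)
    (_hu : Literature.Analysis.FluidPDE.Torus.IsGlobalLerayHopf ν (fun _ => marchioroForce α) u₀ u),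
    Tendsto (fun t => eLpNorm (u t - marchioroLaminarState α ν) 2 volume) atTop (𝓝 0)

/-- **Corollary (uniqueness of the steady state).** Under `Marchioro1986_globalAttraction`:
if a global Leray–Hopf solution with datum `u₀ ∈ H` and force `marchioroForce α` is *steady*,
`u(t) = u₀` for all `t ≥ 0`, then `u₀` is the laminar state `ū = f_α/(4π²ν)` almost
everywhere — the only stationary state is the laminar one, at every Reynolds number
(Marchioro 1986, Theorem; FMRT 2001, Ch. III §3.1: "there is only one fixed point"). Proved
from the named fact. [cite: FoiasManleyRosaTemam2001, Ch. III §3.1] -/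
theorem Marchioro1986_globalAttraction.steadyState_ae_eq (h : Marchioro1986_globalAttraction)
    (α ν : ℝ) (hν : 0 < ν) (u₀ : 𝕋² → E²) (hu₀ : MemLp u₀ 2 volume)
    (hdiv : Literature.Analysis.FunctionSpaces.Torus.IsWeaklyDivFree u₀) (hmean : Literature.Analysis.FunctionSpaces.Torus.HasZeroMean u₀) (u : ℝ → 𝕋² → E²)
    (hu : Literature.Analysis.FluidPDE.Torus.IsGlobalLerayHopf ν (fun _ => marchioroForce α) u₀ u)
    (hsteady : ∀ t, 0 ≤ t → u t = u₀) :
    u₀ =ᵐ[volume] marchioroLaminarState α ν := by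
  have ht := h α ν hν u₀ hu₀ hdiv hmean u hu
  have hmeas : AEStronglyMeasurable (u₀ - marchioroLaminarState α ν) volume :=
    hu₀.1.sub (marchioroLaminarState_continuous α ν).aestronglyMeasurable
  -- along `t → ∞` the distance is eventually the constant `‖u₀ - ū‖₂`
  have hconst : (fun t => eLpNorm (u t - marchioroLaminarState α ν) 2 volume) =ᶠ[atTop]
      fun _ => eLpNorm (u₀ - marchioroLaminarState α ν) 2 volume := by
    filter_upwards [eventually_ge_atTop (0 : ℝ)] with t ht0
    rw [hsteady t ht0]
  have hlim : Tendsto (fun _ : ℝ => eLpNorm (u₀ - marchioroLaminarState α ν) 2 volume) atTop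
      (𝓝 0) := ht.congr' hconst
  have hzero : eLpNorm (u₀ - marchioroLaminarState α ν) 2 volume = 0 :=
    tendsto_nhds_unique tendsto_const_nhds hlim
  have hae : u₀ - marchioroLaminarState α ν =ᵐ[volume] 0 :=
    (eLpNorm_eq_zero_iff hmeas (by norm_num)).1 hzero
  filter_upwards [hae] with x hx
  simpa [sub_eq_zero] using hx


/-! ### Audit 2026-08-15 (D-0021 barrier audit): Galilean drift and the exact scope of the barrier

Marchioro (2)–(3) and FMRT's `H = Ḣ_per` impose `∫ u = 0`; the tree's Leray–Hopf solutions need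
not have zero mean (Galilean invariance, `Torus.IsWeakNSSolutionForcedOn`). With mean momentum
`c = ∫ u₀` (conserved, the force having zero mean) the Galilean change of frame of FMRT, Ch. II
(2.6)–(2.9) turns the steady force `f_α` into the translating force `f_α(x + ct)`, which is still
valued in the first eigenspace at every time, so (A.32)–(A.34) and the first-shell linear ODE of
App. III.A.4 go through verbatim: the long-time state is the *drifting laminar state* below —
steady in the laboratory frame, with BOUNDED energy as `ν → 0` when `c·k ≠ 0`, and vanishing
dissipation. -/

/-- The `sin` amplitude `a = α√2 ν/(c₀² + 4π²ν²)` of the drifting laminar state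
(`marchioroDriftState`). [folklore] -/
def driftSinCoeff (α ν c₀ : ℝ) : ℝ :=
  α * Real.sqrt 2 * ν / (c₀ ^ 2 + 4 * Real.pi ^ 2 * ν ^ 2)

/-- The `cos` amplitude `b = -α√2 c₀/(2π(c₀² + 4π²ν²))` of the drifting laminar state
(`marchioroDriftState`). [folklore] -/
def driftCosCoeff (α ν c₀ : ℝ) : ℝ :=
  -(α * Real.sqrt 2 * c₀) / (2 * Real.pi * (c₀ ^ 2 + 4 * Real.pi ^ 2 * ν ^ 2))

/-- **The drifting laminar states (Galilean family of exact steady solutions).** For a mean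
momentum `c = (c₀, c₁) ∈ ℝ²` and every `ν`, the field
`v_{α,ν,c}(x) = c + (a sin(2πx₀) + b cos(2πx₀)) e₁`, `a = driftSinCoeff α ν c₀`,
`b = driftCosCoeff α ν c₀`, is an exact *steady* solution of the 2-D Navier–Stokes equations on
the unit torus with force `f_α = marchioroForce α` and constant pressure: `(v·∇)v = c₀ ∂₀v`
(shear profile along `e₁` depending on `x₀` only), and `c₀∂₀v - νΔv = f_α` is the `2 × 2` system
`2πc₀ a + 4π²ν b = 0`, `4π²ν a - 2πc₀ b = α√2` (`driftCoeff_steady_system`). Energy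
`‖v‖²_{L²} = |c|² + (a² + b²)/2 = |c|² + α²/(4π²(c₀² + 4π²ν²))`, dissipation
`ν‖∇v‖² = 2π²ν(a² + b²) = να²/(c₀² + 4π²ν²) = ∫⟪f_α, v⟫`. For `c = 0` it is the laminar state `ū`
(`marchioroDriftState_zero`); for `c₀ = 0` it is `ū` translated along its own streamlines. This is
the Galilean reduction of FMRT 2001, Ch. II (2.6)–(2.9) made explicit for the force (3.31); the
"Galileo boosts in the stream wise and span wise directions" are the neutral modes of the
Kolmogorov profile (van Veen–Goto 2016, §2.2). Written with the accepted `Torus.stokesMode`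
(`sin` branch `false`, `cos` branch `true`, frequency `k = (1,0)`). [cite: FoiasManleyRosaTemam2001, Ch. II (2.6)–(2.9)] -/
def marchioroDriftState (α ν : ℝ) (c : E²) : 𝕋² → E² := fun x =>
  c + (Literature.Analysis.FluidPDE.Torus.stokesMode (Pi.single 0 1)
        (driftSinCoeff α ν (c 0) • EuclideanSpace.single 1 1) false x
      + Literature.Analysis.FluidPDE.Torus.stokesMode (Pi.single 0 1)
        (driftCosCoeff α ν (c 0) • EuclideanSpace.single 1 1) true x)

/-- Without cross-stream drift the `sin` amplitude is the laminar one, `a = α√2/(4π²ν)`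
(both sides are the junk value `0` at `ν = 0`). [folklore] -/
theorem driftSinCoeff_zero (α ν : ℝ) :
    driftSinCoeff α ν 0 = (4 * Real.pi ^ 2 * ν)⁻¹ * (α * Real.sqrt 2) := by
  unfold driftSinCoeff
  by_cases hν : ν = 0
  · simp [hν]
  · have hπ : Real.pi ≠ 0 := Real.pi_ne_zero
    field_simp
    ring

/-- Without cross-stream drift the `cos` amplitude vanishes. [folklore] -/
theorem driftCosCoeff_zero (α ν : ℝ) : driftCosCoeff α ν 0 = 0 := by
  simp [driftCosCoeff]

/-- **Consistency with the barrier:** at zero mean momentum the drifting laminar state is the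
laminar fixed point `ū = f_α/(4π²ν)` of (3.34). [folklore] -/
theorem marchioroDriftState_zero (α ν : ℝ) :
    marchioroDriftState α ν 0 = marchioroLaminarState α ν := by
  funext x
  have h0 : (0 : E²) 0 = 0 := rfl
  simp only [marchioroDriftState, marchioroLaminarState_apply, marchioroForce,
    Literature.Analysis.FluidPDE.Torus.stokesMode_apply, h0, driftSinCoeff_zero, driftCosCoeff_zero,
    zero_smul, smul_zero, add_zero, zero_add, smul_smul, Bool.false_eq_true, if_false]
  congr 1
  ring

/-- **The steady Navier–Stokes system on the first shell with drift.** The amplitudes `a`, `b`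
solve `2πc₀ a + 4π²ν b = 0` (the `cos 2πx₀` component of `c₀∂₀v - νΔv - f_α = 0`) and
`4π²ν a - 2πc₀ b = α√2` (its `sin 2πx₀` component), whenever `c₀² + 4π²ν² ≠ 0`. [folklore] -/
theorem driftCoeff_steady_system (α ν c₀ : ℝ) (h : c₀ ^ 2 + 4 * Real.pi ^ 2 * ν ^ 2 ≠ 0) :
    2 * Real.pi * c₀ * driftSinCoeff α ν c₀ + 4 * Real.pi ^ 2 * ν * driftCosCoeff α ν c₀ = 0 ∧
    4 * Real.pi ^ 2 * ν * driftSinCoeff α ν c₀ - 2 * Real.pi * c₀ * driftCosCoeff α ν c₀ =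
      α * Real.sqrt 2 := by
  have hπ : Real.pi ≠ 0 := Real.pi_ne_zero
  unfold driftSinCoeff driftCosCoeff
  constructor
  · field_simp
    ring
  · field_simp
    ring

/-- **Squared amplitude of the oscillation:** `a² + b² = (α√2)²/(4π²(c₀² + 4π²ν²))`, i.e.
energy of the oscillating part `(a² + b²)/2 = α²/(4π²(c₀² + 4π²ν²))` and dissipation
`2π²ν(a² + b²) = να²/(c₀² + 4π²ν²)` — bounded energy, vanishing dissipation as `ν → 0` at fixed
`c₀ ≠ 0`. [folklore] -/
theorem sq_add_sq_driftCoeff (α ν c₀ : ℝ) (h : c₀ ^ 2 + 4 * Real.pi ^ 2 * ν ^ 2 ≠ 0) :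
    driftSinCoeff α ν c₀ ^ 2 + driftCosCoeff α ν c₀ ^ 2 =
      (α * Real.sqrt 2) ^ 2 / (4 * Real.pi ^ 2 * (c₀ ^ 2 + 4 * Real.pi ^ 2 * ν ^ 2)) := by
  have hπ : Real.pi ≠ 0 := Real.pi_ne_zero
  set D : ℝ := c₀ ^ 2 + 4 * Real.pi ^ 2 * ν ^ 2 with hD
  have h2πD : 2 * Real.pi * D ≠ 0 := mul_ne_zero (mul_ne_zero two_ne_zero hπ) h
  have h4D : 4 * Real.pi ^ 2 * D ≠ 0 := mul_ne_zero (mul_ne_zero (by norm_num) (pow_ne_zero 2 hπ)) h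
  simp only [driftSinCoeff, driftCosCoeff, ← hD]
  rw [div_pow, div_pow, div_add_div _ _ (pow_ne_zero 2 h) (pow_ne_zero 2 h2πD),
    div_eq_div_iff (mul_ne_zero (pow_ne_zero 2 h) (pow_ne_zero 2 h2πD)) h4D]
  rw [hD]
  ring

/-- **The oscillation is bounded uniformly in the viscosity.** For cross-stream drift `c₀ ≠ 0`
and every `ν` (no sign or size condition), `‖v_{α,ν,c}(x) - c‖ ≤ |α|/|c₀|` pointwise: the energy
of the drifting laminar state stays bounded as `ν → 0` at fixed force, in contrast with the
mean-zero laminar state `ū = f_α/(4π²ν)`. (Crude constant: `|a| + |b| ≤ 3√2|α|/(4π|c₀|)`.) [folklore] -/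
theorem norm_marchioroDriftState_sub_le (α ν : ℝ) (c : E²) (hc : c 0 ≠ 0) (x : 𝕋²) :
    ‖marchioroDriftState α ν c x - c‖ ≤ |α| / |c 0| := by
  have hπ : 0 < Real.pi := Real.pi_pos
  set D : ℝ := c 0 ^ 2 + 4 * Real.pi ^ 2 * ν ^ 2 with hD
  have hc2 : 0 < c 0 ^ 2 := by positivity
  have hDpos : 0 < D := by positivity
  -- the oscillating part is `s • e₁`
  set z : ℂ := UnitAddTorus.mFourier (Pi.single (0 : Fin 2) (1 : ℤ)) x with hz
  have hz1 : ‖z‖ = 1 := by simp [hz, UnitAddTorus.mFourier]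
  have hsub : marchioroDriftState α ν c x - c =
      (z.im * driftSinCoeff α ν (c 0) + z.re * driftCosCoeff α ν (c 0)) •
        EuclideanSpace.single (1 : Fin 2) (1 : ℝ) := by
    simp only [marchioroDriftState, Literature.Analysis.FluidPDE.Torus.stokesMode_apply, ← hz,
      Bool.false_eq_true, if_false, if_true, smul_smul, add_smul]
    abel
  rw [hsub, norm_smul, PiLp.norm_single, norm_one, mul_one, Real.norm_eq_abs]
  have him : |z.im| ≤ 1 := hz1 ▸ Complex.abs_im_le_norm z
  have hre : |z.re| ≤ 1 := hz1 ▸ Complex.abs_re_le_norm z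
  -- bounds on the two amplitudes
  have ha : |driftSinCoeff α ν (c 0)| ≤ |α| * Real.sqrt 2 / (4 * Real.pi * |c 0|) := by
    unfold driftSinCoeff
    rw [abs_div, abs_mul, abs_mul, abs_of_pos hDpos, abs_of_nonneg (Real.sqrt_nonneg 2)]
    rw [div_le_div_iff₀ hDpos (by positivity)]
    have key : |ν| * (4 * Real.pi * |c 0|) ≤ D := by
      have : 0 ≤ (|c 0| - 2 * Real.pi * |ν|) ^ 2 := sq_nonneg _
      have hc0 : |c 0| ^ 2 = c 0 ^ 2 := sq_abs _
      have hn : |ν| ^ 2 = ν ^ 2 := sq_abs _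
      nlinarith [this, hc0, hn]
    have hαs : 0 ≤ |α| * Real.sqrt 2 := by positivity
    calc |α| * Real.sqrt 2 * |ν| * (4 * Real.pi * |c 0|)
        = |α| * Real.sqrt 2 * (|ν| * (4 * Real.pi * |c 0|)) := by ring
      _ ≤ |α| * Real.sqrt 2 * D := mul_le_mul_of_nonneg_left key hαs
  have hb : |driftCosCoeff α ν (c 0)| ≤ |α| * Real.sqrt 2 / (2 * Real.pi * |c 0|) := by
    unfold driftCosCoeff
    rw [abs_div, abs_neg, abs_mul, abs_mul, abs_mul, abs_mul, abs_of_pos hDpos,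
      abs_of_nonneg (Real.sqrt_nonneg 2), abs_of_pos hπ, abs_two]
    rw [div_le_div_iff₀ (by positivity) (by positivity)]
    have key : |c 0| * |c 0| ≤ D := by
      have hc0 : |c 0| * |c 0| = c 0 ^ 2 := by rw [← sq, sq_abs]
      rw [hc0, hD]; nlinarith [sq_nonneg ν, sq_nonneg Real.pi]
    have hαs : 0 ≤ |α| * Real.sqrt 2 * (2 * Real.pi) := by positivity
    calc |α| * Real.sqrt 2 * |c 0| * (2 * Real.pi * |c 0|)
        = |α| * Real.sqrt 2 * (2 * Real.pi) * (|c 0| * |c 0|) := by ring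
      _ ≤ |α| * Real.sqrt 2 * (2 * Real.pi) * D := mul_le_mul_of_nonneg_left key hαs
      _ = |α| * Real.sqrt 2 * (2 * Real.pi * D) := by ring
  -- numerics: `√2 ≤ 3/2`, `π ≥ 2`
  have hs2 : Real.sqrt 2 ≤ 3 / 2 := by
    rw [show (3 / 2 : ℝ) = Real.sqrt ((3 / 2) ^ 2) by rw [Real.sqrt_sq]; norm_num]
    exact Real.sqrt_le_sqrt (by norm_num)
  have hπ2 : (2 : ℝ) ≤ Real.pi := Real.two_le_pi
  have hc0pos : 0 < |c 0| := abs_pos.mpr hc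
  calc |z.im * driftSinCoeff α ν (c 0) + z.re * driftCosCoeff α ν (c 0)|
      ≤ |z.im * driftSinCoeff α ν (c 0)| + |z.re * driftCosCoeff α ν (c 0)| := abs_add_le _ _
    _ = |z.im| * |driftSinCoeff α ν (c 0)| + |z.re| * |driftCosCoeff α ν (c 0)| := by
        rw [abs_mul, abs_mul]
    _ ≤ 1 * |driftSinCoeff α ν (c 0)| + 1 * |driftCosCoeff α ν (c 0)| := by
        gcongr
    _ ≤ |α| * Real.sqrt 2 / (4 * Real.pi * |c 0|) + |α| * Real.sqrt 2 / (2 * Real.pi * |c 0|) := by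
        rw [one_mul, one_mul]; exact add_le_add ha hb
    _ = |α| / |c 0| * (3 * Real.sqrt 2 / (4 * Real.pi)) := by
        field_simp; ring
    _ ≤ |α| / |c 0| * 1 := by
        refine mul_le_mul_of_nonneg_left ?_ (by positivity)
        rw [div_le_one (by positivity)]
        nlinarith [hs2, hπ2, Real.sqrt_nonneg 2]
    _ = |α| / |c 0| := mul_one _


/-! ### Audit 2026-08-15, generation 6 (D-0021 barrier audit): the single-shell pincer

For a force valued in one eigenspace `E_λ` of the Stokes operator the energy and enstrophy
balances combine into `½ d/dt (‖u‖² - λ|u|²) = -ν (|Au|² - λ‖u‖²)` (2-D periodic: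
`(B(u,u), Au) = 0`; `(f, Au) = λ(f, u)`), and the spectral inequality
`|Au|² - λ‖u‖² ≥ λ(‖u‖² - λ|u|²)` — termwise `(λ_k - λ)² ≥ 0` — closes it into
`ξ(t) ≤ ξ(t₀)e^{-2νλ(t - t₀)}`, `ξ = ‖u‖² - λ|u|²`: Tran–Shepherd's dynamical constraint
`‖u‖² ≤ λ|u|²` on the attractor (Physica D 165 (2002), §4), Marchioro's case being `λ = λ₁`
(then `ξ ≥ 0` by Poincaré and `ξ → 0`, (A.32)–(A.33)). The spectral inequality is recorded here
in the additive `[0, ∞]`-valued form of the tree's Fourier vocabulary (cf. `enstrophyExcess` of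
the Excess sibling, the case `λ = λ₁ = 4π²`). -/

/-- **The single-shell pincer, spectral core** (`|Au|² - Λ‖u‖² ≥ Λ(‖u‖² - Λ|u|²)`, written
additively in `[0, ∞]`): for every field `v` on `𝕋²` and every level `Λ ≥ 0`,
`2Λ ∑_k 4π²|k|² ‖v̂(k)‖² ≤ ∑_k (4π²|k|²)² ‖v̂(k)‖² + Λ² ∑_k ‖v̂(k)‖²` (coefficients of the
complexified field; termwise `(4π²|k|² - Λ)² ≥ 0`). With `Λ = λ` the eigenvalue of a single
forced shell this is the inequality turning `½ξ' = -ν(|Au|² - λ‖u‖²)` into `½ξ' ≤ -νλξ`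
(Tran–Shepherd 2002, §4, eq. (ξ); Constantin–Foias–Manley 1994; Alexakis–Doering 2006, §4).
[cite: TranShepherd2002, §4 eq. (ξ) and (constraint)] -/
theorem shellPincer_spectral (Λ : ℝ) (hΛ : 0 ≤ Λ) (v : 𝕋² → E²) :
    2 * ENNReal.ofReal Λ *
        ∑' k : Fin 2 → ℤ, ENNReal.ofReal (4 * Real.pi ^ 2 * Literature.Analysis.FunctionSpaces.Torus.freqNormSq k) *
          ‖UnitAddTorus.mFourierCoeff (Literature.Analysis.FunctionSpaces.EuclideanSpace.complexify ∘ v) k‖ₑ ^ 2 ≤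
      ∑' k : Fin 2 → ℤ, ENNReal.ofReal ((4 * Real.pi ^ 2 * Literature.Analysis.FunctionSpaces.Torus.freqNormSq k) ^ 2) *
          ‖UnitAddTorus.mFourierCoeff (Literature.Analysis.FunctionSpaces.EuclideanSpace.complexify ∘ v) k‖ₑ ^ 2 +
        ENNReal.ofReal (Λ ^ 2) *
          ∑' k : Fin 2 → ℤ, ‖UnitAddTorus.mFourierCoeff (Literature.Analysis.FunctionSpaces.EuclideanSpace.complexify ∘ v) k‖ₑ ^ 2 := by
  rw [← ENNReal.tsum_mul_left, ← ENNReal.tsum_mul_left, ← ENNReal.tsum_add]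
  refine ENNReal.tsum_le_tsum fun k => ?_
  set a : ℝ≥0∞ := ‖UnitAddTorus.mFourierCoeff (Literature.Analysis.FunctionSpaces.EuclideanSpace.complexify ∘ v) k‖ₑ ^ 2
  set μ : ℝ := 4 * Real.pi ^ 2 * Literature.Analysis.FunctionSpaces.Torus.freqNormSq k
  have hμ0 : 0 ≤ μ := by
    have := Literature.Analysis.FunctionSpaces.Torus.freqNormSq_nonneg k
    positivity
  -- termwise AM–GM: `2Λμ ≤ μ² + Λ²`
  have key : ENNReal.ofReal (2 * Λ * μ) ≤ ENNReal.ofReal (μ ^ 2) + ENNReal.ofReal (Λ ^ 2) := by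
    rw [← ENNReal.ofReal_add (sq_nonneg _) (sq_nonneg _)]
    exact ENNReal.ofReal_le_ofReal (by nlinarith [sq_nonneg (μ - Λ)])
  calc 2 * ENNReal.ofReal Λ * (ENNReal.ofReal μ * a)
      = ENNReal.ofReal (2 * Λ * μ) * a := by
        rw [ENNReal.ofReal_mul (by positivity : (0:ℝ) ≤ 2 * Λ), ENNReal.ofReal_mul (by norm_num : (0:ℝ) ≤ 2),
          ENNReal.ofReal_ofNat]
        ring
    _ ≤ (ENNReal.ofReal (μ ^ 2) + ENNReal.ofReal (Λ ^ 2)) * a := by gcongr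
    _ = ENNReal.ofReal (μ ^ 2) * a + ENNReal.ofReal (Λ ^ 2) * a := add_mul _ _ _

end Literature.Barriers.AnomalousDissipation

end
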